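/-
Copyright: public-domain mathematics; typed transcription for the H21 Literature library (cell pub-balaban, PAPER SUB-CELL B05 gen 4).

# Bałaban, *Propagators and renormalization transformations for lattice gauge theories. I*,
# Commun. Math. Phys. **95** (1984) 17–40 — Proposition 1.2, step S1′: (1.89), (1.126) ⇒ (1.114) by the L² walk expansion

[cite: Balaban1984PropagatorsI]  T. Bałaban, Commun. Math. Phys. 95 (1984) 17–40 (= B5 of the series), pp. 36–39
(PDF pages 20–23), with (1.71) p. 30 and Proposition 1.1 (1.89) p. 33.

WHAT THIS MODULE IS.  Gen 1 of this sub-cell (`B5.prop12_of_printed_steps`) assembled Proposition 1.2 from its printed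
steps and left the step S1′ — "(1.114) for G from (1.89) by the same expansion in L²" — as the hypothesis
`S1' : Prop11Printed fam → Kernel126_127Printed K → Local114Fam fam` (the same slot reappears in
`B5Transfer132.prop12_via132_of_printed_steps`, gen 3).  The printed support for S1′ is one sentence, p. 39, verbatim:

  "The proofs of the other inequalities are exactly the same, but in the estimates of G∇*J we have to take a
  representation of G adjoint to (1.123), with the operators K(h) acting on the right.
  Thus we have to prove inequalities (1.115)–(1.117).  Let us notice that the proof of inequalities (1.114),
  describing the decay in L²-norms, is completed because we have proved inequalities (1.89)."

i.e. (1.114) is the L² reading of the random-walk argument (1.118)–(1.131) that pp. 36–38 display for `‖ζ∇G∇*J‖_α`.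
THIS FILE KERNEL-CHECKS THAT ARGUMENT IN L², over an abstract real inner-product space `V` (the L² sections on `T_η`)
with `G`, `Δ_a`, `∇`, `h_z`, `ζ` as linear operators, and DISCHARGES THE SLOT `S1′` modulo located printed-shape leaves:

§1 (algebra, pp. 36–37).  p. 36, verbatim: "We construct a partition of unity taking the functions
`h_z(x) = Π_{μ=1}^d h((x_μ − z_μ)/M₀)`, `h ∈ C₀^∞(]−⅔, ⅔[)`, `h(t) = 1` for `t ∈ [−⅓, ⅓]`, h is chosen in such a way that
`Σ_n h²(t − n) = 1`, hence `Σ_z h_z²(x) = 1`.  (1.118)  We define an operator C₀ by the formula `C₀ = Σ_z h_zGh_z`.  (1.119)";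
p. 37, verbatim: "These equalities imply `Δ_a hA = … = hΔ_aA − K(h)A`,  (1.121)
`Δ_aC₀ = Δ_a Σ_z h_zGh_z = Σ_z (h_zΔ_aGh_z − K(h_z)Gh_z) = I − Σ_z K(h_z)Gh_z = I − R`,  (1.122)  and we get the desired
representation  `G = C₀(I − R)⁻¹ = Σ_{ω=(ω₀,ω₁,…,ω_n)} h_{ω₀}Gh_{ω₀}K(h_{ω₁})Gh_{ω₁}·…·h_{ω_{n−1}}K(h_{ω_n})Gh_{ω_n}`,  (1.123)
where the summation is over all finite sequences ω with `ω_i ∈ T^{(k+m₀)}_{M₀}`.  Of course the sum is convergent only if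
R is small in a proper sense.  This holds if M₀ is sufficiently large."  Typed: `Kop` (`K(h) = hΔ_a − Δ_a h`), `C0`,
`Rop`, `deltaA_mul_C0` ((1.122)), `G_eq_C0_add` (`G = C₀ + GR`), `telescope`, the walk words `U` with `sum_H_U` /
`sum_K_U`, and `walk_expansion` = (1.123) TRUNCATED at length `M+1` with the exact remainder `G·R^{M+1}` as a walk sum.

§2 (analysis of one instance, p. 38: `Model`).  Hypotheses = the printed inputs (1.118), (1.71), the symmetry of `G`
(p. 33, verbatim: "The operator G is a symmetric operator on L²(T_η)") and of the `h_z`, (1.89) for `‖GB‖`, `‖∇GB‖`,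
and (1.128) in L² form (p. 38, verbatim: "Defining `2δ₀ = min{⅓δ′₀, M₀⁻¹}`, we obtain
`|h_{z₁}K(h_{z₂})A| ≤ O(M₀⁻¹) e^{−2δ₀|z₁−z₂|} (|∇A| + |A|)`.  (1.128)").  Derived: `norm_H_le` (`‖h_z v‖ ≤ ‖v‖` from
(1.118) + symmetry), `norm_K_le`, `tail_bound` (the factors (1.128)·(1.89) along a walk give `(2γθ)^m ×` the printed
weight `e^{−2δ₀|ω₀−ω₁|}⋯`), `first_bound` (slot for (1.125)), `lastSum_le`, and the two assemblies of (1.131):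
`right_entry` — an entry `ζ D₁ G D₂ J` expanded by (1.123) on the right (terms `right_terms_sum` = (1.130) for the
one-factor term, (1.125)·(1.128)ⁿ·(1.129) for the others; the walk sums bounded by `B5Walk131.walkSeries_le` = the second
inequality of (1.131); the remainder `right_remainder_sum ≤ const·(2γθK̄)^{M+1} → 0`, `le_of_forall_geom`) — and
`left_entry` — an entry `ζ G D₂ J` through "a representation of G adjoint to (1.123), with the operators K(h) acting on
the right" (p. 39), realised by inner-product DUALITY `⟨φ, ζGD₂J⟩ = ⟨D₂†G(ζφ), J⟩` and the right expansion of `G(ζφ)`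
(`left_terms_sum`, `left_remainder_sum`, `norm_le_of_inner_bound`).

§3 (the family, p. 39: `Consts`, `RightCert`, `LeftCert`, `Realisation`, `local114_of_realisation`).  p. 39, verbatim:
"Let us notice that the constant O(1) under the sum above is an absolute constant depending on d only, hence we can fix
M₀ depending on d only, such that the series is convergent."  Typed: given, for every instance `i` and every cube scale
`M₀ ≥ 1`, an L² realisation with constants uniform in `(i, M₀)` (`Realisation`, whose fields are the located leaves
listed below), the theorem `local114_of_realisation : Prop11Printed fam → Kernel126_127Printed Kd → Local114Fam fam`
extracts `γ₀` ((1.89)) and `δ′₀, C` ((1.126)), FIXES `M₀ = ⌈max{1, 3/δ′₀, 4γ₀⁻¹θ̄(δ′₀,C)K̄}⌉` (so `2δ₀ = M₀⁻¹` by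
`B5Walk131.twoDelta0_eq_inv` and the series ratio `2γ₀⁻¹θ̄K̄/M₀ ≤ ½`), and proves (1.114) for all six entries with
`δ₀ = (2M₀)⁻¹` and an explicit `C`; `prop12_of_printed_steps_via_walk` is `B5.prop12_of_printed_steps` with `S1′`
discharged by it.

LOCATED PRINTED-SHAPE LEAVES (fields of `Realisation`; GAPS G-B5-24 — each to be proved on the torus model, T02.1
territory, none proved here): (1.118) `h118`; (1.71) `h71`, `h71'`; symmetry `symmG` (p. 33), `symmH`, `symmCut`;
(1.89) read on the model `h89`; (1.126) ⇒ (1.128) in L² `h128` (p. 38; printed in sup norm — the L² form is what the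
p. 39 sentence uses); per entry the L² forms of the factor bounds — (1.125) p. 38 (verbatim: "For the first factor we
have `‖ζ∇h_zGh_zA‖_α ≤ O(1)(‖ζ‖_α + |ζ|)|h_zA|`.  (1.125)"), (1.129) p. 38 (verbatim: "The last factor in each term is
estimated by using (1.115), (1.116) `|∇Gh_z∇*J| + |Gh_z∇*J| ≤ O(1)(‖J‖_ε + |J|)`"), (1.130) p. 38 (the one-factor
term) — packaged as `RightCert` / `LeftCert` (`hcert`); and the DICTIONARY fields tying the abstract numbers of
`B5.Setting` to the model: `hentry` (`l2loc n J ζ` is the L² norm of the entry `ζ D1ₙ G D2ₙ J`,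
`D1 = (1, ∇, 1, ∇, ∇∇, 1)`, `D2 = (1, 1, ∇*, ∇*, 1, ∇*∇*)`), `hvec`, `hcut`, `hcut0`, `hdist`, the cube-cover geometry
`hν`, `hrow` (p. 36, verbatim: "and cubes □_z of size 2M₀ and with a center at the point z ∈ T^{(k+m₀)}_{M₀}. These cubes
cover the lattice T_η."; `Z^d` model in `B5Walk131` section `Hypotheses`) and the support localities `hJloc` /
the `RightCert`–`LeftCert` locality clauses (supp ζ ⊂ Δ̃(y), supp J ⊂ Δ̃(y′) of (1.114)).

DICTIONARY (printed ↦ typed).  `L²(T_η)`-sections ↦ a real inner-product space `V`;  `G, Δ_a, ∇, h_z, ζ` ↦ `Module.End ℝ V`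
(`G`, `Δa`, `Dg`, `H z`, `cut ζ`);  `|A|` (L² norm, p. 33) ↦ `‖A‖`, `|∇A| + |A|` ↦ `hnorm Dg A`;  `T^{(k+m₀)}_{M₀}` ↦ a finite
type `S` with centres `ctr : S → X` in a pseudometric space `X` ⊇ the sites (`site`), `|y − y′| ≤ dist (site y) (site y′)`;
`y ∈ □_z` (enlarged by the `O(1)` support radii) ↦ `dist (site y) (ctr z) ≤ c̄M₀`;  a walk ↦ `ω : Fin (n+1) → S` and its
weight/sums ↦ `B5Walk131.walkWeight` / `walkSum`;  `O(1)^{2n}M₀^{−n}` ↦ `(2γθ)ⁿ`, `γ = γ₀⁻¹`, `θ = θ̄(δ′₀,C)/M₀`;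
`2δ₀ = min{⅓δ′₀, M₀⁻¹}` ↦ `B5Walk131.twoDelta0 δ′₀ M₀` (`= M₀⁻¹` at the chosen `M₀`);  `Σ_{x∈Z^d} e^{−δ₀M₀|x|}` (`δ₀M₀ = ½`)
↦ the row-sum bound `K̄` (`hrow`).

DEVIATIONS FROM THE PRINTED ARGUMENT (DIVERGENCE D-b05g4.1, none in the resulting statement).  (i) The paper sums the
full Neumann series `G = C₀(I − R)⁻¹`; here (1.123) is truncated with the exact remainder `G R^{M+1}`, bounded by
`const·(2γ₀⁻¹θ̄K̄/M₀)^{M+1}` and sent to zero inside each estimate, so no convergence of an operator series is presupposed.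
(ii) The "representation of G adjoint to (1.123)" for `G∇*J`, `G∇*∇*J` is obtained by duality from the right expansion
rather than written out a second time.  (iii) The factor bounds (1.125), (1.129), (1.130) are printed in Hölder / sup
norms (for (1.113)); their L² readings, which the p. 39 sentence invokes without display, are hypotheses here (leaves
above), not derived from (1.89) in this file.  An independent L² decay certificate for the entry `G` alone by the
Combes–Thomas route of p. 36 ("Probably the simplest proof …") exists in the tree (`Beta/CombesThomasFormOp`, other
units); this file follows the printed random-walk route and does not use it.

WHAT THIS FILE DOES NOT CLAIM.  It does not construct the torus model (`L²(T_η)`, `G = Δ_a⁻¹`, `h_z`, `K(h_z)`, `∂P∂*`),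
prove Proposition 1.1, (1.126)–(1.128), or the L² factor bounds; it does not touch (1.115)–(1.117) (step S1, Hölder
norms), (1.132)–(1.137), or B4.  Value = kernel check of the L² random-walk mechanism (1.118)–(1.131) ⇒ (1.114) with
every analytic input located on the page and the constants (`M₀`, `δ₀`, `C`) chosen before the instance — a typed
skeleton discharging one hypothesis slot of gen 1, NOT summit progress.
-/
import Mathlib
import Literature.MathematicalPhysics.QuantumFieldTheory.Balaban1983to89.B5
import Literature.MathematicalPhysics.QuantumFieldTheory.Balaban1983to89.B5Walk131

/-!
# B5Local114 — Bałaban CMP 95 (1984), Proposition 1.2 step S1′: the L² walk expansion (1.118)–(1.131) ⇒ (1.114)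

[cite: Balaban1984PropagatorsI]  pp. 36–39.  Discharges the slot `S1′ : Prop11Printed fam → Kernel126_127Printed K →
Local114Fam fam` of `B5.prop12_of_printed_steps` (gen 1) modulo LOCATED printed-shape leaves: §1 the algebra
(1.118)–(1.123) (`Kop`, `C0`, `Rop`, `deltaA_mul_C0`, `walk_expansion` — (1.123) truncated with exact remainder);
§2 one instance (`Model`: (1.118), (1.71), symmetry, (1.89), (1.128) ⇒ `tail_bound`, `right_entry`, `left_entry`, the
walk sums bounded by `B5Walk131.walkSeries_le` = (1.131), the adjoint representation of p. 39 by duality);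
§3 the family (`Realisation` = the located leaves + dictionary per instance and cube scale; `local114_of_realisation`
fixes `M₀` "depending on d only, such that the series is convergent" (p. 39) and proves (1.114) for the six entries;
`prop12_of_printed_steps_via_walk`).  See the file header for the verbatim quotations, the leaf list (GAPS G-B5-24),
the dictionary, the deviations (D-b05g4.1) and the disclaimer (typed skeleton, NOT summit progress).
-/

namespace Literature.MathematicalPhysics.QuantumFieldTheory.Balaban1983to89.B5Local114

open Finset
open Literature.MathematicalPhysics.QuantumFieldTheory.Balaban1983to89
open Literature.MathematicalPhysics.QuantumFieldTheory.Balaban1983to89.B5Walk131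

noncomputable section
open Classical

/-! ## §1. The algebra of the random-walk expansion, (1.118)–(1.123) p. 36–37 -/

section Algebra

variable {V : Type} [AddCommGroup V] [Module ℝ V] {S : Type}

/-- The commutator operator `K(h) := hΔ_a − Δ_a h` of (1.121), p. 37, verbatim: "These equalities imply
`Δ_a hA = (Δ − ∂P∂* + aQ*Q)hA = hΔ_aA − [Σ_{b∈st(·)} (∂h)(b)(∂A)(b) − (Δh)A + S*(∂h)QA − Q*S(∂h)A + P₁(∂h)A]
= hΔ_aA − K(h)A`,  (1.121)" — i.e. `Δ_a(hA) = h(Δ_a A) − K(h)A`, so `K(h) = hΔ_a − Δ_a h` as operators (only this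
operator identity is used here, not the printed formula for `K(h)`); for the partition function `h_z = H z`.
[cite: Balaban1984PropagatorsI, (1.121) p.37] -/
def Kop (Δa : Module.End ℝ V) (H : S → Module.End ℝ V) (z : S) : Module.End ℝ V :=
  H z * Δa - Δa * H z

/-- The parametrix `C₀ = Σ_z h_z G h_z` of (1.119), p. 36, verbatim: "We define an operator C₀ by the formula
`C₀ = Σ_z h_zGh_z`.  (1.119)". [cite: Balaban1984PropagatorsI, (1.119) p.36] -/
def C0 [Fintype S] (G : Module.End ℝ V) (H : S → Module.End ℝ V) : Module.End ℝ V := ∑ z, H z * G * H z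

/-- The remainder `R = Σ_z K(h_z) G h_z` of (1.122), p. 37, verbatim: "`Δ_aC₀ = Δ_a Σ_z h_zGh_z = Σ_z (h_zΔ_aGh_z −
K(h_z)Gh_z) = I − Σ_z K(h_z)Gh_z = I − R`,  (1.122)". [cite: Balaban1984PropagatorsI, (1.122) p.37] -/
def Rop [Fintype S] (G Δa : Module.End ℝ V) (H : S → Module.End ℝ V) : Module.End ℝ V :=
  ∑ z, Kop Δa H z * G * H z

/-- pointwise form of `K(h)`. [cite: Balaban1984PropagatorsI, (1.121) p.37] -/
theorem Kop_apply (Δa : Module.End ℝ V) (H : S → Module.End ℝ V) (z : S) (v : V) :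
    Kop Δa H z v = H z (Δa v) - Δa (H z v) := by
  simp [Kop, LinearMap.sub_apply, Module.End.mul_apply]

/-- (1.121) as printed: `Δ_a(h A) = h(Δ_a A) − K(h)A`. [cite: Balaban1984PropagatorsI, (1.121) p.37] -/
theorem deltaA_H_apply (Δa : Module.End ℝ V) (H : S → Module.End ℝ V) (z : S) (A : V) :
    Δa (H z A) = H z (Δa A) - Kop Δa H z A := by
  rw [Kop_apply]; abel

/-- **(1.122)**, p. 37, verbatim: "`Δ_aC₀ = Δ_a Σ_z h_zGh_z = Σ_z (h_zΔ_aGh_z − K(h_z)Gh_z) = I − Σ_z K(h_z)Gh_z = I − R`,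
(1.122)", from (1.121), (1.118) `Σ_z h_z² = 1` and (1.71) `Δ_a G = I`. [cite: Balaban1984PropagatorsI, (1.122) p.37] -/
theorem deltaA_mul_C0 [Fintype S] {G Δa : Module.End ℝ V} {H : S → Module.End ℝ V}
    (h118 : ∑ z, H z * H z = 1) (h71 : Δa * G = 1) : Δa * C0 G H = 1 - Rop G Δa H := by
  unfold C0 Rop
  rw [Finset.mul_sum]
  have key : ∀ z, Δa * (H z * G * H z) = H z * H z - Kop Δa H z * G * H z := by
    intro z
    have e : Δa * H z = H z * Δa - Kop Δa H z := by simp [Kop]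
    calc Δa * (H z * G * H z) = (Δa * H z) * G * H z := by simp only [mul_assoc]
      _ = (H z * Δa - Kop Δa H z) * G * H z := by rw [e]
      _ = H z * (Δa * G) * H z - Kop Δa H z * G * H z := by simp only [sub_mul, mul_assoc]
      _ = H z * H z - Kop Δa H z * G * H z := by rw [h71, mul_one]
  simp_rw [key]
  rw [Finset.sum_sub_distrib, h118]

/-- The fixed-point form of (1.123): `G = C₀ + G R` (from `Δ_a C₀ = I − R` and `GΔ_a = Δ_a G = I`, (1.71)); the paper
writes `G = C₀(I − R)⁻¹`. [cite: Balaban1984PropagatorsI, (1.122)–(1.123) p.37] -/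
theorem G_eq_C0_add [Fintype S] {G Δa : Module.End ℝ V} {H : S → Module.End ℝ V}
    (h118 : ∑ z, H z * H z = 1) (h71 : Δa * G = 1) (h71' : G * Δa = 1) :
    G = C0 G H + G * Rop G Δa H := by
  have h := deltaA_mul_C0 (G := G) h118 h71
  have hC : G * (Δa * C0 G H) = G * (1 - Rop G Δa H) := by rw [h]
  rw [← mul_assoc, h71', one_mul, mul_sub, mul_one] at hC
  rw [hC, sub_add_cancel]

/-- Finite Neumann telescoping of `G = C + G R`: `G = Σ_{n<N} C Rⁿ + G R^N` — the finite truncation of the printed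
`G = C₀(I − R)⁻¹ = Σ_n C₀Rⁿ` (1.123). [cite: Balaban1984PropagatorsI, (1.123) p.37] -/
theorem telescope {G C R : Module.End ℝ V} (hfix : G = C + G * R) (N : ℕ) :
    G = ∑ n ∈ Finset.range N, C * R ^ n + G * R ^ N := by
  induction N with
  | zero => simp
  | succ N ih =>
    calc G = ∑ n ∈ Finset.range N, C * R ^ n + G * R ^ N := ih
      _ = ∑ n ∈ Finset.range N, C * R ^ n + (C + G * R) * R ^ N := by rw [← hfix]
      _ = _ := by rw [add_mul, mul_assoc, ← pow_succ', Finset.sum_range_succ, add_assoc]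

/-- The walk operator of (1.123) WITHOUT its leading `h_{ω₀}`: for a walk `ω = (ω₀, …, ω_m)`,
`U ω = [G h_{ω₀}] [K(h_{ω₁}) G h_{ω₁}] ⋯ [K(h_{ω_m}) G h_{ω_m}]`, so that the `ω`-term of (1.123) is `h_{ω₀} U ω`.
[cite: Balaban1984PropagatorsI, (1.123) p.37] -/
def U (G : Module.End ℝ V) (H K : S → Module.End ℝ V) : (m : ℕ) → (Fin (m + 1) → S) → Module.End ℝ V
  | 0, ω => G * H (ω 0)
  | m + 1, ω => G * H (ω 0) * K (Fin.tail ω 0) * U G H K m (Fin.tail ω)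

/-- unfolding of `U` at length `0`. [cite: Balaban1984PropagatorsI, (1.123) p.37] -/
@[simp] theorem U_zero (G : Module.End ℝ V) (H K : S → Module.End ℝ V) (ω : Fin 1 → S) :
    U G H K 0 ω = G * H (ω 0) := rfl

/-- unfolding of `U` at length `m+1`. [cite: Balaban1984PropagatorsI, (1.123) p.37] -/
@[simp] theorem U_succ (G : Module.End ℝ V) (H K : S → Module.End ℝ V) (m : ℕ) (ω : Fin (m + 1 + 1) → S) :
    U G H K (m + 1) ω = G * H (ω 0) * K (Fin.tail ω 0) * U G H K m (Fin.tail ω) := rfl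

/-- Splitting a sum over walks of length `m+1` into the first site and the tail (the bijection
`Fin.consEquiv`). [folklore: finite sums over `Fin (m+1) → S ≃ S × (Fin m → S)`] -/
theorem sum_cons_split [Fintype S] {M : Type} [AddCommMonoid M] (m : ℕ) (g : S → (Fin m → S) → M) :
    ∑ ω : Fin (m + 1) → S, g (ω 0) (Fin.tail ω) = ∑ z : S, ∑ ω' : Fin m → S, g z ω' := by
  rw [← Fintype.sum_prod_type']
  exact Fintype.sum_equiv (Fin.consEquiv fun _ => S).symm _ _ (fun ω => rfl)

/-- Resummation of the walks by their first step: `Σ_{|ω| = m+1} K(h_{ω₀}) U_ω = R̃^{m+1}` with `R̃ = Σ_z K_z G h_z`.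
[cite: Balaban1984PropagatorsI, (1.122)–(1.123) p.37] -/
theorem sum_K_U [Fintype S] (G : Module.End ℝ V) (H K : S → Module.End ℝ V) :
    ∀ m : ℕ, ∑ ω : Fin (m + 1) → S, K (ω 0) * U G H K m ω = (∑ z, K z * G * H z) ^ (m + 1) := by
  intro m
  induction m with
  | zero =>
    rw [pow_one]
    calc ∑ ω : Fin (0 + 1) → S, K (ω 0) * U G H K 0 ω
        = ∑ ω : Fin (0 + 1) → S, (fun z (_ : Fin 0 → S) => K z * G * H z) (ω 0) (Fin.tail ω) :=
          Finset.sum_congr rfl fun ω _ => by simp only [U_zero, mul_assoc]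
      _ = ∑ z : S, ∑ _ω' : Fin 0 → S, K z * G * H z :=
          sum_cons_split 0 (fun z (_ : Fin 0 → S) => K z * G * H z)
      _ = ∑ z, K z * G * H z := Finset.sum_congr rfl fun z _ => by simp
  | succ m ih =>
    calc ∑ ω : Fin (m + 1 + 1) → S, K (ω 0) * U G H K (m + 1) ω
        = ∑ ω : Fin (m + 1 + 1) → S,
            (fun z (ω' : Fin (m + 1) → S) => (K z * G * H z) * (K (ω' 0) * U G H K m ω')) (ω 0) (Fin.tail ω) :=
          Finset.sum_congr rfl fun ω _ => by simp only [U_succ, mul_assoc]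
      _ = ∑ z : S, ∑ ω' : Fin (m + 1) → S, (K z * G * H z) * (K (ω' 0) * U G H K m ω') :=
          sum_cons_split (m + 1) (fun z (ω' : Fin (m + 1) → S) => (K z * G * H z) * (K (ω' 0) * U G H K m ω'))
      _ = ∑ z : S, (K z * G * H z) * (∑ z, K z * G * H z) ^ (m + 1) :=
          Finset.sum_congr rfl fun z _ => by rw [← Finset.mul_sum, ih]
      _ = (∑ z, K z * G * H z) ^ (m + 1 + 1) := by rw [← Finset.sum_mul, pow_succ' _ (m + 1)]

/-- Resummation with the leading `h_{ω₀}`: `Σ_{|ω| = m+1} h_{ω₀} U_ω = C₀ R̃^m` — the `m`-th term of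
`C₀(I − R)⁻¹ = Σ_m C₀ R^m` written as the walk sum (1.123). [cite: Balaban1984PropagatorsI, (1.123) p.37] -/
theorem sum_H_U [Fintype S] (G : Module.End ℝ V) (H K : S → Module.End ℝ V) (m : ℕ) :
    ∑ ω : Fin (m + 1) → S, H (ω 0) * U G H K m ω = (∑ z, H z * G * H z) * (∑ z, K z * G * H z) ^ m := by
  cases m with
  | zero =>
    rw [pow_zero, mul_one]
    calc ∑ ω : Fin (0 + 1) → S, H (ω 0) * U G H K 0 ω
        = ∑ ω : Fin (0 + 1) → S, (fun z (_ : Fin 0 → S) => H z * G * H z) (ω 0) (Fin.tail ω) :=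
          Finset.sum_congr rfl fun ω _ => by simp only [U_zero, mul_assoc]
      _ = ∑ z : S, ∑ _ω' : Fin 0 → S, H z * G * H z :=
          sum_cons_split 0 (fun z (_ : Fin 0 → S) => H z * G * H z)
      _ = ∑ z, H z * G * H z := Finset.sum_congr rfl fun z _ => by simp
  | succ m =>
    calc ∑ ω : Fin (m + 1 + 1) → S, H (ω 0) * U G H K (m + 1) ω
        = ∑ ω : Fin (m + 1 + 1) → S,
            (fun z (ω' : Fin (m + 1) → S) => (H z * G * H z) * (K (ω' 0) * U G H K m ω')) (ω 0) (Fin.tail ω) :=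
          Finset.sum_congr rfl fun ω _ => by simp only [U_succ, mul_assoc]
      _ = ∑ z : S, ∑ ω' : Fin (m + 1) → S, (H z * G * H z) * (K (ω' 0) * U G H K m ω') :=
          sum_cons_split (m + 1) (fun z (ω' : Fin (m + 1) → S) => (H z * G * H z) * (K (ω' 0) * U G H K m ω'))
      _ = ∑ z : S, (H z * G * H z) * (∑ z, K z * G * H z) ^ (m + 1) :=
          Finset.sum_congr rfl fun z _ => by rw [← Finset.mul_sum, sum_K_U]
      _ = (∑ z, H z * G * H z) * (∑ z, K z * G * H z) ^ (m + 1) := by rw [← Finset.sum_mul]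

/-- **The (finite) random-walk expansion (1.123)**, p. 37, verbatim: "and we get the desired representation
`G = C₀(I − R)⁻¹ = Σ_{ω=(ω₀,ω₁,…,ω_n)} h_{ω₀}Gh_{ω₀}K(h_{ω₁})Gh_{ω₁}·…·h_{ω_{n−1}}K(h_{ω_n})Gh_{ω_n}`, (1.123) where the
summation is over all finite sequences ω with `ω_i ∈ T^{(k+m₀)}_{M₀}`. Of course the sum is convergent only if R is
small in a proper sense. This holds if M₀ is sufficiently large.", here truncated at length `M+1` with the exact
remainder `G R^{M+1}` written as a walk sum (so that no convergence of the Neumann series is presupposed: the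
remainder is shown to tend to zero inside each estimate below). [cite: Balaban1984PropagatorsI, (1.123) p.37] -/
theorem walk_expansion [Fintype S] {G Δa : Module.End ℝ V} {H : S → Module.End ℝ V}
    (h118 : ∑ z, H z * H z = 1) (h71 : Δa * G = 1) (h71' : G * Δa = 1) (M : ℕ) :
    G = ∑ m ∈ Finset.range (M + 1), ∑ ω : Fin (m + 1) → S, H (ω 0) * U G H (Kop Δa H) m ω
        + ∑ ω : Fin (M + 1) → S, G * Kop Δa H (ω 0) * U G H (Kop Δa H) M ω := by
  have hfix := G_eq_C0_add h118 h71 h71'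
  conv_lhs => rw [telescope hfix (M + 1)]
  congr 1
  · refine Finset.sum_congr rfl fun m _ => ?_
    rw [sum_H_U]; rfl
  · rw [Rop, ← sum_K_U G H (Kop Δa H) M, Finset.mul_sum]
    refine Finset.sum_congr rfl fun ω _ => ?_
    simp only [mul_assoc]

/-- A walk term vanishes on vectors killed by its last localisation `h_{ω_m}` (used for the support restrictions
`y′ ∈ □_{ω_n}` of (1.131)). [cite: Balaban1984PropagatorsI, (1.123) p.37, (1.131) p.38] -/
theorem U_apply_eq_zero (G : Module.End ℝ V) (H K : S → Module.End ℝ V) :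
    ∀ (m : ℕ) (ω : Fin (m + 1) → S) (B : V), H (ω (Fin.last m)) B = 0 → U G H K m ω B = 0 := by
  intro m
  induction m with
  | zero =>
    intro ω B h
    have h0 : H (ω 0) B = 0 := by simpa using h
    simp [Module.End.mul_apply, h0]
  | succ m ih =>
    intro ω B h
    have ht : U G H K m (Fin.tail ω) B = 0 :=
      ih (Fin.tail ω) B (by simpa [Fin.tail, Fin.succ_last] using h)
    simp [Module.End.mul_apply, ht]

end Algebra

/-! ## §2. The L² estimates along one walk: (1.128), (1.89) ⇒ the terms of (1.131), and the two entry theorems -/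

section Analysis

variable {V : Type} [NormedAddCommGroup V] [InnerProductSpace ℝ V] {S X : Type} [Fintype S]
  [PseudoMetricSpace X]

/-- The size `|∇A| + |A|` appearing on the right of (1.128) (an `H¹`-type norm, `Dg` = the covariant gradient `∇` as
an operator into the same `L²` carrier). [cite: Balaban1984PropagatorsI, (1.128) p.38] -/
def hnorm (Dg : Module.End ℝ V) (A : V) : ℝ := ‖Dg A‖ + ‖A‖

/-- [folklore: sum of norms is nonnegative] -/
theorem hnorm_nonneg (Dg : Module.End ℝ V) (A : V) : 0 ≤ hnorm Dg A :=
  add_nonneg (norm_nonneg _) (norm_nonneg _)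

/-- [folklore: norms of `0`] -/
@[simp] theorem hnorm_zero (Dg : Module.End ℝ V) : hnorm Dg 0 = 0 := by simp [hnorm]

/-- [folklore] -/
theorem norm_le_hnorm (Dg : Module.End ℝ V) (A : V) : ‖A‖ ≤ hnorm Dg A :=
  le_add_of_nonneg_left (norm_nonneg _)

/-- **One instance of the L² walk machine of pp. 36–39.**  Data: the L² carrier `V` (a real inner-product space —
`L²` sections over `T_η`), the operators `G = Δ_a⁻¹`, `Δ_a`, the gradient `Dg = ∇`, the partition of unity `h_z = H z`
indexed by the finite set `S` of `M₀`-cube centres embedded by `ctr` in a pseudometric space `X`, and the printed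
inputs, each a field quoted from the paper:
* `h118` — (1.118) p. 36, verbatim: "h is chosen in such a way that `Σ_n h²(t − n) = 1`, hence `Σ_z h_z²(x) = 1`.
  (1.118)";
* `h71`, `h71'` — (1.71) p. 30, verbatim: "We will obtain an explicit representation of `Δ_a⁻¹ = G_k`, or simply G.
  (1.71)" … "It is an invertible operator";
* `symmG` — p. 33, Prop. 1.1, verbatim: "The operator G is a symmetric operator on L²(T_η)"; `symmH` — the `h_z` are
  real multiplication operators [folklore];
* `h89`, `h89'` — (1.89) p. 33, verbatim: "`‖GJ‖, ‖∇GJ‖, ‖G∇*J‖, ‖∇G∇*J‖, ‖∇∇GJ‖, ‖G∇*∇*J‖ ≤ γ₀^{−1}‖J‖`" (the first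
  two, with `γ = γ₀⁻¹`);
* `h128` — (1.128) p. 38, verbatim: "Defining `2δ₀ = min{⅓δ′₀, M₀⁻¹}`, we obtain
  `|h_{z₁}K(h_{z₂})A| ≤ O(M₀⁻¹) e^{−2δ₀|z₁−z₂|} (|∇A| + |A|)`.  (1.128)" (with `θ = O(M₀⁻¹)`).
[cite: Balaban1984PropagatorsI, (1.118)–(1.128) pp.36–38, (1.89) p.33] -/
structure Model (V : Type) [NormedAddCommGroup V] [InnerProductSpace ℝ V] (S X : Type) [Fintype S]
    [PseudoMetricSpace X] where
  /-- `G = Δ_a⁻¹` on `L²`. -/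
  G : Module.End ℝ V
  /-- `Δ_a`. -/
  Δa : Module.End ℝ V
  /-- the partition of unity `h_z`, (1.118). -/
  H : S → Module.End ℝ V
  /-- the gradient `∇` (as an operator of the carrier). -/
  Dg : Module.End ℝ V
  /-- cube centres. -/
  ctr : S → X
  /-- `γ = γ₀⁻¹` of (1.89). -/
  γ : ℝ
  /-- `θ = O(M₀⁻¹)` of (1.128). -/
  θ : ℝ
  /-- `δ₀` of (1.128). -/
  δ₀ : ℝ
  /-- half-width of the cubes `□_z` in `X` (`y ∈ □_z` ↔ `dist y (ctr z) ≤ c`). -/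
  c : ℝ
  h118 : ∑ z, H z * H z = 1
  h71 : Δa * G = 1
  h71' : G * Δa = 1
  symmG : ∀ u v : V, inner ℝ (G u) v = inner ℝ u (G v)
  symmH : ∀ (z : S) (u v : V), inner ℝ (H z u) v = inner ℝ u (H z v)
  h89 : ∀ B : V, ‖G B‖ ≤ γ * ‖B‖
  h89' : ∀ B : V, ‖Dg (G B)‖ ≤ γ * ‖B‖
  h128 : ∀ (z₁ z₂ : S) (A : V),
    ‖H z₁ (Kop Δa H z₂ A)‖ ≤ θ * Real.exp (-(2 * δ₀ * dist (ctr z₁) (ctr z₂))) * (‖Dg A‖ + ‖A‖)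
  γ_pos : 0 < γ
  θ_nonneg : 0 ≤ θ
  δ₀_nonneg : 0 ≤ δ₀

namespace Model

variable (M : Model V S X)

/-- `‖h_z v‖ ≤ ‖v‖`, DERIVED from (1.118) `Σ h_z² = 1` and the symmetry of the `h_z`:
`‖v‖² = Σ_z ‖h_z v‖²`. [cite: Balaban1984PropagatorsI, (1.118) p.36] -/
theorem norm_H_le (z : S) (v : V) : ‖M.H z v‖ ≤ ‖v‖ := by
  have h1 : ∑ z', M.H z' (M.H z' v) = v := by
    have := LinearMap.congr_fun M.h118 v
    simpa [LinearMap.sum_apply, Module.End.mul_apply] using this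
  have hsum : ∑ z', ‖M.H z' v‖ ^ 2 = ‖v‖ ^ 2 := by
    calc ∑ z', ‖M.H z' v‖ ^ 2 = ∑ z', inner ℝ (M.H z' v) (M.H z' v) := by
          simp
      _ = ∑ z', inner ℝ v (M.H z' (M.H z' v)) := Finset.sum_congr rfl fun z' _ => M.symmH z' v _
      _ = inner ℝ v (∑ z', M.H z' (M.H z' v)) := (inner_sum _ _ _).symm
      _ = ‖v‖ ^ 2 := by rw [h1, real_inner_self_eq_norm_sq]
  have hle : ‖M.H z v‖ ^ 2 ≤ ‖v‖ ^ 2 := by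
    rw [← hsum]
    exact Finset.single_le_sum (f := fun z' => ‖M.H z' v‖ ^ 2) (fun z' _ => sq_nonneg _) (Finset.mem_univ z)
  have h := Real.sqrt_le_sqrt hle
  rwa [Real.sqrt_sq (norm_nonneg _), Real.sqrt_sq (norm_nonneg _)] at h

/-- `|∇(GB)| + |GB| ≤ 2γ₀⁻¹‖B‖` from (1.89). [cite: Balaban1984PropagatorsI, (1.89) p.33] -/
theorem hnorm_G_le (w : V) : hnorm M.Dg (M.G w) ≤ 2 * M.γ * ‖w‖ := by
  unfold hnorm; have := M.h89 w; have := M.h89' w; linarith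

/-- row sums at rate `2δ₀` are bounded by row sums at rate `δ₀` (`Σ_{x} e^{−δ₀M₀|x|}` of (1.131)).
[cite: Balaban1984PropagatorsI, (1.131) p.38] -/
theorem col_two_le {K : ℝ} (hrow : ∀ a : S, ∑ b : S, Real.exp (-(M.δ₀ * dist (M.ctr a) (M.ctr b))) ≤ K)
    (b : S) : ∑ a : S, Real.exp (-(2 * M.δ₀ * dist (M.ctr a) (M.ctr b))) ≤ K := by
  refine le_trans (Finset.sum_le_sum fun a _ => ?_) (hrow b)
  rw [dist_comm]
  apply Real.exp_le_exp.mpr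
  have := mul_nonneg M.δ₀_nonneg (dist_nonneg : 0 ≤ dist (M.ctr b) (M.ctr a))
  linarith

/-- The UNPAIRED commutator bound: `‖K(h_z)u‖ ≤ θ (Σ_{z₁} e^{−2δ₀|z₁−z|}) (|∇u| + |u|) ≤ θ K (|∇u| + |u|)`, from (1.128)
by inserting `Σ_{z₁} h_{z₁}² = 1` (1.118); used only for the remainder `G R^{M+1}`.
[cite: Balaban1984PropagatorsI, (1.128) p.38, (1.118) p.36] -/
theorem norm_K_le {K : ℝ} (hrow : ∀ a : S, ∑ b : S, Real.exp (-(M.δ₀ * dist (M.ctr a) (M.ctr b))) ≤ K)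
    (z : S) (u : V) : ‖Kop M.Δa M.H z u‖ ≤ M.θ * K * hnorm M.Dg u := by
  have hexp : Kop M.Δa M.H z u = ∑ z₁, M.H z₁ (M.H z₁ (Kop M.Δa M.H z u)) := by
    have := LinearMap.congr_fun M.h118 (Kop M.Δa M.H z u)
    simp only [LinearMap.sum_apply, Module.End.mul_apply, Module.End.one_apply] at this
    exact this.symm
  have hre : ∀ z₁, M.θ * Real.exp (-(2 * M.δ₀ * dist (M.ctr z₁) (M.ctr z))) * hnorm M.Dg u
      = (M.θ * hnorm M.Dg u) * Real.exp (-(2 * M.δ₀ * dist (M.ctr z₁) (M.ctr z))) := by intro; ring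
  calc ‖Kop M.Δa M.H z u‖ = ‖∑ z₁, M.H z₁ (M.H z₁ (Kop M.Δa M.H z u))‖ := congrArg _ hexp
    _ ≤ ∑ z₁, ‖M.H z₁ (M.H z₁ (Kop M.Δa M.H z u))‖ := norm_sum_le _ _
    _ ≤ ∑ z₁, ‖M.H z₁ (Kop M.Δa M.H z u)‖ := Finset.sum_le_sum fun z₁ _ => M.norm_H_le _ _
    _ ≤ ∑ z₁, M.θ * Real.exp (-(2 * M.δ₀ * dist (M.ctr z₁) (M.ctr z))) * hnorm M.Dg u :=
        Finset.sum_le_sum fun z₁ _ => M.h128 z₁ z u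
    _ = (M.θ * hnorm M.Dg u) * ∑ z₁, Real.exp (-(2 * M.δ₀ * dist (M.ctr z₁) (M.ctr z))) := by
        simp_rw [hre]; rw [Finset.mul_sum]
    _ ≤ (M.θ * hnorm M.Dg u) * K :=
        mul_le_mul_of_nonneg_left (M.col_two_le hrow z) (mul_nonneg M.θ_nonneg (hnorm_nonneg _ _))
    _ = M.θ * K * hnorm M.Dg u := by ring

end Model

omit [Fintype S] in
/-- the empty walk weight. [cite: Balaban1984PropagatorsI, (1.131) p.38] -/
theorem walkWeight_zero (ctr : S → X) (κ : ℝ) (ω : Fin (0 + 1) → S) : walkWeight ctr κ 0 ω = 1 := by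
  simp [walkWeight]

omit [Fintype S] in
/-- peeling the first step off a walk weight. [cite: Balaban1984PropagatorsI, (1.131) p.38] -/
theorem walkWeight_succ (ctr : S → X) (κ : ℝ) (m : ℕ) (ω : Fin (m + 1 + 1) → S) :
    walkWeight ctr κ (m + 1) ω
      = Real.exp (-(κ * dist (ctr (ω 0)) (ctr (Fin.tail ω 0)))) * walkWeight ctr κ m (Fin.tail ω) := by
  unfold walkWeight
  rw [Fin.prod_univ_succ]
  rfl

namespace Model

variable (M : Model V S X)

/-- **The product estimate along one walk** (the factors of (1.131)): for `u = U_ω B`,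
`|∇u| + |u| ≤ (2γθ)^m e^{−2δ₀|ω₀−ω₁|}⋯e^{−2δ₀|ω_{m−1}−ω_m|} (|∇ G h_{ω_m} B| + |G h_{ω_m} B|)`, by iterating (1.89) and
(1.128). [cite: Balaban1984PropagatorsI, (1.128), (1.131) p.38, (1.89) p.33] -/
theorem tail_bound : ∀ (m : ℕ) (ω : Fin (m + 1) → S) (B : V),
    hnorm M.Dg (U M.G M.H (Kop M.Δa M.H) m ω B)
      ≤ (2 * M.γ * M.θ) ^ m * walkWeight M.ctr (2 * M.δ₀) m ω
          * hnorm M.Dg (M.G (M.H (ω (Fin.last m)) B)) := by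
  intro m
  induction m with
  | zero =>
    intro ω B
    simp [walkWeight, Module.End.mul_apply]
  | succ m ih =>
    intro ω B
    have hU : U M.G M.H (Kop M.Δa M.H) (m + 1) ω B
        = M.G (M.H (ω 0) (Kop M.Δa M.H (Fin.tail ω 0) (U M.G M.H (Kop M.Δa M.H) m (Fin.tail ω) B))) := by
      simp [Module.End.mul_apply]
    have hlast : (Fin.tail ω) (Fin.last m) = ω (Fin.last (m + 1)) := by
      simp [Fin.tail, Fin.succ_last]
    have ih' := ih (Fin.tail ω) B
    rw [hlast] at ih'
    have h2 := M.h128 (ω 0) (Fin.tail ω 0) (U M.G M.H (Kop M.Δa M.H) m (Fin.tail ω) B)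
    have hE0 : 0 ≤ Real.exp (-(2 * M.δ₀ * dist (M.ctr (ω 0)) (M.ctr (Fin.tail ω 0)))) := (Real.exp_pos _).le
    have hW0 : 0 ≤ walkWeight M.ctr (2 * M.δ₀) m (Fin.tail ω) := walkWeight_nonneg _ _ _ _
    have hL0 : 0 ≤ hnorm M.Dg (M.G (M.H (ω (Fin.last (m + 1))) B)) := hnorm_nonneg _ _
    have hγ := M.γ_pos
    have hθ := M.θ_nonneg
    have hΘ0 : 0 ≤ 2 * M.γ * M.θ := by positivity
    rw [hU, walkWeight_succ]
    calc hnorm M.Dg (M.G (M.H (ω 0) (Kop M.Δa M.H (Fin.tail ω 0) (U M.G M.H (Kop M.Δa M.H) m (Fin.tail ω) B))))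
        ≤ 2 * M.γ * ‖M.H (ω 0) (Kop M.Δa M.H (Fin.tail ω 0) (U M.G M.H (Kop M.Δa M.H) m (Fin.tail ω) B))‖ :=
          M.hnorm_G_le _
      _ ≤ 2 * M.γ * (M.θ * Real.exp (-(2 * M.δ₀ * dist (M.ctr (ω 0)) (M.ctr (Fin.tail ω 0))))
            * hnorm M.Dg (U M.G M.H (Kop M.Δa M.H) m (Fin.tail ω) B)) := by
          gcongr; exact h2
      _ ≤ 2 * M.γ * (M.θ * Real.exp (-(2 * M.δ₀ * dist (M.ctr (ω 0)) (M.ctr (Fin.tail ω 0))))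
            * ((2 * M.γ * M.θ) ^ m * walkWeight M.ctr (2 * M.δ₀) m (Fin.tail ω)
                * hnorm M.Dg (M.G (M.H (ω (Fin.last (m + 1))) B)))) := by
          gcongr
      _ = (2 * M.γ * M.θ) ^ (m + 1) * (Real.exp (-(2 * M.δ₀ * dist (M.ctr (ω 0)) (M.ctr (Fin.tail ω 0))))
            * walkWeight M.ctr (2 * M.δ₀) m (Fin.tail ω)) * hnorm M.Dg (M.G (M.H (ω (Fin.last (m + 1))) B)) := by
          ring

/-- **The first factor of a walk term**, printed (1.125) p. 38: "For the first factor we have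
`‖ζ∇h_zGh_zA‖_α ≤ O(1)(‖ζ‖_α + |ζ|)|h_zA|`.  (1.125)", here
in its L² form as the hypothesis `hF : ‖D (h_z G B)‖ ≤ C_F ‖B‖` (`D` = the left derivative(s) of the entry), combined
with `tail_bound`: the `ω`-term of length `m+2` is at most `C_F θ (2γθ)^m × weight × last factor`.
[cite: Balaban1984PropagatorsI, (1.125), (1.128), (1.131) p.38] -/
theorem first_bound {D : Module.End ℝ V} {CF : ℝ} (hF : ∀ (z : S) (B : V), ‖D (M.H z (M.G B))‖ ≤ CF * ‖B‖)
    (hCF : 0 ≤ CF) (m : ℕ) (ω : Fin (m + 1 + 1) → S) (B : V) :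
    ‖D (M.H (ω 0) (U M.G M.H (Kop M.Δa M.H) (m + 1) ω B))‖
      ≤ CF * M.θ * (2 * M.γ * M.θ) ^ m * walkWeight M.ctr (2 * M.δ₀) (m + 1) ω
          * hnorm M.Dg (M.G (M.H (ω (Fin.last (m + 1))) B)) := by
  have hU : U M.G M.H (Kop M.Δa M.H) (m + 1) ω B
      = M.G (M.H (ω 0) (Kop M.Δa M.H (Fin.tail ω 0) (U M.G M.H (Kop M.Δa M.H) m (Fin.tail ω) B))) := by
    simp [Module.End.mul_apply]
  have hlast : (Fin.tail ω) (Fin.last m) = ω (Fin.last (m + 1)) := by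
    simp [Fin.tail, Fin.succ_last]
  have ht := M.tail_bound m (Fin.tail ω) B
  rw [hlast] at ht
  have h2 := M.h128 (ω 0) (Fin.tail ω 0) (U M.G M.H (Kop M.Δa M.H) m (Fin.tail ω) B)
  have hE0 : 0 ≤ Real.exp (-(2 * M.δ₀ * dist (M.ctr (ω 0)) (M.ctr (Fin.tail ω 0)))) := (Real.exp_pos _).le
  have hW0 : 0 ≤ walkWeight M.ctr (2 * M.δ₀) m (Fin.tail ω) := walkWeight_nonneg _ _ _ _
  have hL0 : 0 ≤ hnorm M.Dg (M.G (M.H (ω (Fin.last (m + 1))) B)) := hnorm_nonneg _ _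
  have hγ := M.γ_pos
  have hθ := M.θ_nonneg
  have hΘ0 : 0 ≤ 2 * M.γ * M.θ := by positivity
  rw [hU, walkWeight_succ]
  calc ‖D (M.H (ω 0) (M.G (M.H (ω 0) (Kop M.Δa M.H (Fin.tail ω 0) (U M.G M.H (Kop M.Δa M.H) m (Fin.tail ω) B)))))‖
      ≤ CF * ‖M.H (ω 0) (Kop M.Δa M.H (Fin.tail ω 0) (U M.G M.H (Kop M.Δa M.H) m (Fin.tail ω) B))‖ := hF _ _
    _ ≤ CF * (M.θ * Real.exp (-(2 * M.δ₀ * dist (M.ctr (ω 0)) (M.ctr (Fin.tail ω 0))))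
            * hnorm M.Dg (U M.G M.H (Kop M.Δa M.H) m (Fin.tail ω) B)) := by
        gcongr; exact h2
    _ ≤ CF * (M.θ * Real.exp (-(2 * M.δ₀ * dist (M.ctr (ω 0)) (M.ctr (Fin.tail ω 0))))
            * ((2 * M.γ * M.θ) ^ m * walkWeight M.ctr (2 * M.δ₀) m (Fin.tail ω)
                * hnorm M.Dg (M.G (M.H (ω (Fin.last (m + 1))) B)))) := by
        gcongr
    _ = CF * M.θ * (2 * M.γ * M.θ) ^ m * (Real.exp (-(2 * M.δ₀ * dist (M.ctr (ω 0)) (M.ctr (Fin.tail ω 0))))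
            * walkWeight M.ctr (2 * M.δ₀) m (Fin.tail ω)) * hnorm M.Dg (M.G (M.H (ω (Fin.last (m + 1))) B)) := by
        ring

end Model

/-- **Summing walk weights with a mark on the LAST site** (the remainder bookkeeping): if `0 ≤ ind ≤ …` with
`Σ_z ind z ≤ ν` and the column sums at rate `κ` are `≤ K`, then `Σ_{|ω| = m+1} ind(ω_m) w_κ(ω) ≤ ν K^m`.
[cite: Balaban1984PropagatorsI, (1.131) p.38] -/
theorem lastSum_le (ctr : S → X) (κ K ν : ℝ) (hK : 0 ≤ K)
    (hcol : ∀ b : S, ∑ a : S, Real.exp (-(κ * dist (ctr a) (ctr b))) ≤ K)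
    (ind : S → ℝ) (h0 : ∀ z, 0 ≤ ind z) (hν : ∑ z, ind z ≤ ν) :
    ∀ m : ℕ, ∑ ω : Fin (m + 1) → S, ind (ω (Fin.last m)) * walkWeight ctr κ m ω ≤ ν * K ^ m := by
  intro m
  induction m with
  | zero =>
    rw [pow_zero, mul_one]
    calc ∑ ω : Fin (0 + 1) → S, ind (ω (Fin.last 0)) * walkWeight ctr κ 0 ω
        = ∑ ω : Fin (0 + 1) → S, (fun z (_ : Fin 0 → S) => ind z) (ω 0) (Fin.tail ω) :=
          Finset.sum_congr rfl fun ω _ => by simp [walkWeight]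
      _ = ∑ z : S, ∑ _ω' : Fin 0 → S, ind z := sum_cons_split 0 (fun z (_ : Fin 0 → S) => ind z)
      _ = ∑ z, ind z := Finset.sum_congr rfl fun z _ => by simp
      _ ≤ ν := hν
  | succ m ih =>
    have hνK : 0 ≤ ν * K ^ m := le_trans (Finset.sum_nonneg fun ω _ =>
      mul_nonneg (h0 _) (walkWeight_nonneg _ _ _ _)) ih
    calc ∑ ω : Fin (m + 1 + 1) → S, ind (ω (Fin.last (m + 1))) * walkWeight ctr κ (m + 1) ω
        = ∑ ω : Fin (m + 1 + 1) → S, (fun z (ω' : Fin (m + 1) → S) =>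
            Real.exp (-(κ * dist (ctr z) (ctr (ω' 0)))) * (ind (ω' (Fin.last m)) * walkWeight ctr κ m ω'))
              (ω 0) (Fin.tail ω) := by
          refine Finset.sum_congr rfl fun ω _ => ?_
          have hlast : (Fin.tail ω) (Fin.last m) = ω (Fin.last (m + 1)) := by
            simp [Fin.tail, Fin.succ_last]
          simp only [walkWeight_succ, hlast]
          ring
      _ = ∑ z : S, ∑ ω' : Fin (m + 1) → S,
            Real.exp (-(κ * dist (ctr z) (ctr (ω' 0)))) * (ind (ω' (Fin.last m)) * walkWeight ctr κ m ω') :=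
          sum_cons_split (m + 1) (fun z (ω' : Fin (m + 1) → S) =>
            Real.exp (-(κ * dist (ctr z) (ctr (ω' 0)))) * (ind (ω' (Fin.last m)) * walkWeight ctr κ m ω'))
      _ = ∑ ω' : Fin (m + 1) → S, (∑ z : S, Real.exp (-(κ * dist (ctr z) (ctr (ω' 0)))))
            * (ind (ω' (Fin.last m)) * walkWeight ctr κ m ω') := by
          rw [Finset.sum_comm]
          refine Finset.sum_congr rfl fun ω' _ => ?_
          rw [Finset.sum_mul]
      _ ≤ ∑ ω' : Fin (m + 1) → S, K * (ind (ω' (Fin.last m)) * walkWeight ctr κ m ω') :=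
          Finset.sum_le_sum fun ω' _ => mul_le_mul_of_nonneg_right (hcol _)
            (mul_nonneg (h0 _) (walkWeight_nonneg _ _ _ _))
      _ = K * ∑ ω' : Fin (m + 1) → S, ind (ω' (Fin.last m)) * walkWeight ctr κ m ω' := by
          rw [Finset.mul_sum]
      _ ≤ K * (ν * K ^ m) := mul_le_mul_of_nonneg_left ih hK
      _ = ν * K ^ (m + 1) := by ring

/-- elimination of a geometric remainder: `x ≤ a + b qⁿ` for all `n` with `0 ≤ q < 1` gives `x ≤ a`.
[folklore: `qⁿ → 0`] -/
theorem le_of_forall_geom {x a b q : ℝ} (hq0 : 0 ≤ q) (hq1 : q < 1)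
    (h : ∀ n : ℕ, x ≤ a + b * q ^ n) : x ≤ a := by
  have ht : Filter.Tendsto (fun n : ℕ => a + b * q ^ n) Filter.atTop (nhds (a + b * 0)) :=
    tendsto_const_nhds.add ((tendsto_pow_atTop_nhds_zero_of_lt_one hq0 hq1).const_mul b)
  rw [mul_zero, add_zero] at ht
  exact ge_of_tendsto' ht fun n => h n

/-- norm from a uniform bound on inner products (Riesz, `φ = v`). [folklore: `‖v‖² = ⟨v,v⟩`] -/
theorem norm_le_of_inner_bound {v : V} {B : ℝ} (hB : 0 ≤ B) (h : ∀ φ : V, |inner ℝ φ v| ≤ B * ‖φ‖) :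
    ‖v‖ ≤ B := by
  by_cases hv : v = 0
  · simp [hv, hB]
  · have hpos : 0 < ‖v‖ := norm_pos_iff.mpr hv
    have h1 := h v
    rw [real_inner_self_eq_norm_sq, abs_of_nonneg (sq_nonneg _)] at h1
    nlinarith

namespace Model

variable (M : Model V S X)

/-- **The `ω`-terms of (1.131) for a RIGHT entry `ζ D₁ G D₂ J`** (`D₁ ∈ {∇, ∇∇, ∇ (paired with D₂ = ∇*)}` on the left,
`D₂` on the right): the sum over walks of length `m+1` of `‖ζ D₁ h_{ω₀} U_ω D₂ J‖` is at most
`(C₁ + C_F C_L/(2γ)) |ζ| ‖J‖ (2γθ)^m × walkSum` — terms with `y ∉ □_{ω₀}` or `y′ ∉ □_{ω_m}` vanish by the localities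
`hZloc`, `hJloc`; the term `m = 0` is the printed one-factor estimate (1.130) (`hOne`), the terms `m ≥ 1` use the first
factor (1.125) (`hF`), the product estimate `tail_bound` and the last factor (1.129) (`hL`, verbatim p. 38: "The last
factor in each term is estimated by using (1.115), (1.116)
`|∇Gh_z∇*J| + |Gh_z∇*J| ≤ O(1)(‖J‖_ε + |J|) ≤ O(1)(‖J‖_{α+ε} + |J|)`.  (1.129)", here in L² form).
[cite: Balaban1984PropagatorsI, (1.125)–(1.131) p.38] -/
theorem right_terms_sum {D₁ D₂ Zc : Module.End ℝ V} {CF CL C1 s nJ : ℝ} (hCF : 0 ≤ CF) (hCL : 0 ≤ CL)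
    (hC1 : 0 ≤ C1) (hs : 0 ≤ s) (hnJ : 0 ≤ nJ) {y y' : X} {J : V}
    (hF : ∀ (z : S) (B : V), ‖D₁ (M.H z (M.G B))‖ ≤ CF * ‖B‖)
    (hZ : ∀ v, ‖Zc v‖ ≤ s * ‖v‖)
    (hZloc : ∀ z, ¬ dist y (M.ctr z) ≤ M.c → Zc * D₁ * M.H z = 0)
    (hJloc : ∀ z, ¬ dist (M.ctr z) y' ≤ M.c → M.H z (D₂ J) = 0)
    (hL : ∀ z, hnorm M.Dg (M.G (M.H z (D₂ J))) ≤ CL * nJ)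
    (hOne : ∀ z, ‖Zc (D₁ (M.H z (M.G (M.H z (D₂ J)))))‖ ≤ C1 * s * nJ) (m : ℕ) :
    ∑ ω : Fin (m + 1) → S, ‖Zc (D₁ (M.H (ω 0) (U M.G M.H (Kop M.Δa M.H) m ω (D₂ J))))‖
      ≤ (C1 + CF * CL / (2 * M.γ)) * s * nJ * ((2 * M.γ * M.θ) ^ m * walkSum M.ctr M.δ₀ M.c m y y') := by
  have hγ := M.γ_pos
  have hθ := M.θ_nonneg
  have hΘ0 : 0 ≤ 2 * M.γ * M.θ := by positivity
  have hA0 : 0 ≤ CF * CL / (2 * M.γ) := by positivity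
  unfold walkSum
  rw [Finset.mul_sum, Finset.mul_sum]
  refine Finset.sum_le_sum fun ω _ => ?_
  split_ifs with h
  · cases m with
    | zero =>
      rw [walkWeight_zero, pow_zero, mul_one, mul_one]
      calc ‖Zc (D₁ (M.H (ω 0) (U M.G M.H (Kop M.Δa M.H) 0 ω (D₂ J))))‖
          = ‖Zc (D₁ (M.H (ω 0) (M.G (M.H (ω 0) (D₂ J)))))‖ := by simp [Module.End.mul_apply]
        _ ≤ C1 * s * nJ := hOne _
        _ ≤ (C1 + CF * CL / (2 * M.γ)) * s * nJ := by
            have : 0 ≤ CF * CL / (2 * M.γ) * s * nJ := by positivity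
            nlinarith
    | succ m =>
      set W := walkWeight M.ctr (2 * M.δ₀) (m + 1) ω with hW
      have hW0 : 0 ≤ W := walkWeight_nonneg _ _ _ _
      have hfb := M.first_bound hF hCF m ω (D₂ J)
      have hlast := hL (ω (Fin.last (m + 1)))
      have key : (C1 + CF * CL / (2 * M.γ)) * s * nJ * ((2 * M.γ * M.θ) ^ (m + 1) * W)
          = C1 * s * nJ * ((2 * M.γ * M.θ) ^ (m + 1) * W)
            + s * (CF * M.θ * (2 * M.γ * M.θ) ^ m * W * (CL * nJ)) := by
        field_simp
        ring
      rw [key]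
      have hpos : 0 ≤ C1 * s * nJ * ((2 * M.γ * M.θ) ^ (m + 1) * W) := by positivity
      calc ‖Zc (D₁ (M.H (ω 0) (U M.G M.H (Kop M.Δa M.H) (m + 1) ω (D₂ J))))‖
          ≤ s * ‖D₁ (M.H (ω 0) (U M.G M.H (Kop M.Δa M.H) (m + 1) ω (D₂ J)))‖ := hZ _
        _ ≤ s * (CF * M.θ * (2 * M.γ * M.θ) ^ m * W * hnorm M.Dg (M.G (M.H (ω (Fin.last (m + 1))) (D₂ J)))) :=
            mul_le_mul_of_nonneg_left hfb hs
        _ ≤ s * (CF * M.θ * (2 * M.γ * M.θ) ^ m * W * (CL * nJ)) := by gcongr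
        _ ≤ _ := by linarith
  · rw [mul_zero, mul_zero]
    rw [not_and_or] at h
    rcases h with hy | hy'
    · have hz := LinearMap.congr_fun (hZloc (ω 0) hy) (U M.G M.H (Kop M.Δa M.H) m ω (D₂ J))
      simp only [Module.End.mul_apply, LinearMap.zero_apply] at hz
      rw [hz, norm_zero]
    · have hU := U_apply_eq_zero M.G M.H (Kop M.Δa M.H) m ω (D₂ J) (hJloc _ hy')
      rw [hU]; simp

/-- **The remainder `Σ_ω ζ D₁ G K(h_{ω₀}) U_ω D₂ J` of the truncated expansion** (right entry): at most
`|ζ| C_F θK C_L‖J‖ ν (2γθ K)^M`, which tends to `0` as `M → ∞` since `2γθK < 1` ("we can fix M₀ … such that the series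
is convergent", p. 39). [cite: Balaban1984PropagatorsI, (1.131) p.38, p.39] -/
theorem right_remainder_sum {D₁ D₂ Zc : Module.End ℝ V} {CF CL s nJ K ν : ℝ} (hCF : 0 ≤ CF) (hCL : 0 ≤ CL)
    (hs : 0 ≤ s) (hnJ : 0 ≤ nJ) (hK : 0 ≤ K) {y' : X} {J : V}
    (hrow : ∀ a : S, ∑ b : S, Real.exp (-(M.δ₀ * dist (M.ctr a) (M.ctr b))) ≤ K)
    (hν : ((Finset.univ.filter fun z : S => dist y' (M.ctr z) ≤ M.c).card : ℝ) ≤ ν)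
    (hDG : ∀ B : V, ‖D₁ (M.G B)‖ ≤ CF * ‖B‖)
    (hZ : ∀ v, ‖Zc v‖ ≤ s * ‖v‖)
    (hJloc : ∀ z, ¬ dist (M.ctr z) y' ≤ M.c → M.H z (D₂ J) = 0)
    (hL : ∀ z, hnorm M.Dg (M.G (M.H z (D₂ J))) ≤ CL * nJ) (Mm : ℕ) :
    ∑ ω : Fin (Mm + 1) → S,
        ‖Zc (D₁ (M.G (Kop M.Δa M.H (ω 0) (U M.G M.H (Kop M.Δa M.H) Mm ω (D₂ J)))))‖
      ≤ s * CF * (M.θ * K) * (CL * nJ) * ν * ((2 * M.γ * M.θ) ^ Mm * K ^ Mm) := by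
  have hγ := M.γ_pos
  have hθ := M.θ_nonneg
  have hΘ0 : 0 ≤ 2 * M.γ * M.θ := by positivity
  set ind : S → ℝ := fun z => if dist y' (M.ctr z) ≤ M.c then 1 else 0 with hind
  have h0 : ∀ z, 0 ≤ ind z := by intro z; simp only [hind]; split_ifs <;> norm_num
  have hνsum : ∑ z, ind z ≤ ν := by
    have : ∑ z, ind z = ((Finset.univ.filter fun z : S => dist y' (M.ctr z) ≤ M.c).card : ℝ) := by
      simp only [hind]
      rw [Finset.sum_boole]
    rw [this]; exact hν
  have hlast : ∀ ω : Fin (Mm + 1) → S,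
      hnorm M.Dg (M.G (M.H (ω (Fin.last Mm)) (D₂ J))) ≤ CL * nJ * ind (ω (Fin.last Mm)) := by
    intro ω
    simp only [hind]
    split_ifs with hc
    · rw [mul_one]; exact hL _
    · have : ¬ dist (M.ctr (ω (Fin.last Mm))) y' ≤ M.c := by rwa [dist_comm] at hc
      rw [hJloc _ this, map_zero, hnorm_zero, mul_zero]
  have hterm : ∀ ω : Fin (Mm + 1) → S,
      ‖Zc (D₁ (M.G (Kop M.Δa M.H (ω 0) (U M.G M.H (Kop M.Δa M.H) Mm ω (D₂ J)))))‖
        ≤ s * CF * (M.θ * K) * (CL * nJ) * (2 * M.γ * M.θ) ^ Mm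
            * (ind (ω (Fin.last Mm)) * walkWeight M.ctr (2 * M.δ₀) Mm ω) := by
    intro ω
    set u := U M.G M.H (Kop M.Δa M.H) Mm ω (D₂ J) with hu
    have htb := M.tail_bound Mm ω (D₂ J)
    have hW0 : 0 ≤ walkWeight M.ctr (2 * M.δ₀) Mm ω := walkWeight_nonneg _ _ _ _
    calc ‖Zc (D₁ (M.G (Kop M.Δa M.H (ω 0) u)))‖ ≤ s * ‖D₁ (M.G (Kop M.Δa M.H (ω 0) u))‖ := hZ _
      _ ≤ s * (CF * ‖Kop M.Δa M.H (ω 0) u‖) := by gcongr; exact hDG _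
      _ ≤ s * (CF * (M.θ * K * hnorm M.Dg u)) := by gcongr; exact M.norm_K_le hrow _ _
      _ ≤ s * (CF * (M.θ * K * ((2 * M.γ * M.θ) ^ Mm * walkWeight M.ctr (2 * M.δ₀) Mm ω
            * hnorm M.Dg (M.G (M.H (ω (Fin.last Mm)) (D₂ J)))))) := by gcongr
      _ ≤ s * (CF * (M.θ * K * ((2 * M.γ * M.θ) ^ Mm * walkWeight M.ctr (2 * M.δ₀) Mm ω
            * (CL * nJ * ind (ω (Fin.last Mm)))))) := by gcongr; exact hlast ω
      _ = _ := by ring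
  calc ∑ ω : Fin (Mm + 1) → S, ‖Zc (D₁ (M.G (Kop M.Δa M.H (ω 0) (U M.G M.H (Kop M.Δa M.H) Mm ω (D₂ J)))))‖
      ≤ ∑ ω : Fin (Mm + 1) → S, s * CF * (M.θ * K) * (CL * nJ) * (2 * M.γ * M.θ) ^ Mm
            * (ind (ω (Fin.last Mm)) * walkWeight M.ctr (2 * M.δ₀) Mm ω) := Finset.sum_le_sum fun ω _ => hterm ω
    _ = s * CF * (M.θ * K) * (CL * nJ) * (2 * M.γ * M.θ) ^ Mm
            * ∑ ω : Fin (Mm + 1) → S, ind (ω (Fin.last Mm)) * walkWeight M.ctr (2 * M.δ₀) Mm ω := by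
        rw [Finset.mul_sum]
    _ ≤ s * CF * (M.θ * K) * (CL * nJ) * (2 * M.γ * M.θ) ^ Mm * (ν * K ^ Mm) := by
        apply mul_le_mul_of_nonneg_left _ (by positivity)
        exact lastSum_le M.ctr (2 * M.δ₀) K ν hK (M.col_two_le hrow) ind h0 hνsum Mm
    _ = _ := by ring

/-- **RIGHT ENTRY THEOREM — the L² form of the display (1.131) and its conclusion (1.114) for one entry
`ζ D₁ G D₂ J`.**  From the walk expansion (1.123), the localities of `ζ` (near `y`) and `J` (near `y′`), the printed
factor estimates (1.125) `hF`/`hDG`, (1.128) (in `M`), (1.129) `hL`, (1.130) `hOne`, and the walk-sum bound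
`B5Walk131.walkSeries_le` ((1.131), second inequality, kernel-checked in gen 2):
`‖ζ D₁ G D₂ J‖ ≤ (C₁ + C_F C_L/(2γ)) ν e^{2δ₀c} (1 − 2γθK)⁻¹ e^{−δ₀ d(y,y′)} |ζ| ‖J‖`.
[cite: Balaban1984PropagatorsI, (1.123) p.37, (1.125)–(1.131) p.38, (1.114) p.36] -/
theorem right_entry {K ν : ℝ} (hK : 0 ≤ K)
    (hrow : ∀ a : S, ∑ b : S, Real.exp (-(M.δ₀ * dist (M.ctr a) (M.ctr b))) ≤ K)
    (hν : ∀ x : X, ((Finset.univ.filter fun z : S => dist x (M.ctr z) ≤ M.c).card : ℝ) ≤ ν)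
    (hsmall : 2 * M.γ * M.θ * K < 1)
    {D₁ D₂ Zc : Module.End ℝ V} {CF CL C1 s nJ : ℝ} (hCF : 0 ≤ CF) (hCL : 0 ≤ CL) (hC1 : 0 ≤ C1)
    (hs : 0 ≤ s) (hnJ : 0 ≤ nJ) {y y' : X} {J : V}
    (hF : ∀ (z : S) (B : V), ‖D₁ (M.H z (M.G B))‖ ≤ CF * ‖B‖)
    (hDG : ∀ B : V, ‖D₁ (M.G B)‖ ≤ CF * ‖B‖)
    (hZ : ∀ v, ‖Zc v‖ ≤ s * ‖v‖)
    (hZloc : ∀ z, ¬ dist y (M.ctr z) ≤ M.c → Zc * D₁ * M.H z = 0)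
    (hJloc : ∀ z, ¬ dist (M.ctr z) y' ≤ M.c → M.H z (D₂ J) = 0)
    (hL : ∀ z, hnorm M.Dg (M.G (M.H z (D₂ J))) ≤ CL * nJ)
    (hOne : ∀ z, ‖Zc (D₁ (M.H z (M.G (M.H z (D₂ J)))))‖ ≤ C1 * s * nJ) :
    ‖Zc (D₁ (M.G (D₂ J)))‖
      ≤ (C1 + CF * CL / (2 * M.γ)) * ν * Real.exp (2 * M.δ₀ * M.c) * (1 - 2 * M.γ * M.θ * K)⁻¹
          * Real.exp (-(M.δ₀ * dist y y')) * s * nJ := by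
  have hγ := M.γ_pos
  have hθ := M.θ_nonneg
  have hΘ0 : 0 ≤ 2 * M.γ * M.θ := by positivity
  have hν0 : 0 ≤ ν := le_trans (Nat.cast_nonneg _) (hν y)
  have hq0 : 0 ≤ 2 * M.γ * M.θ * K := by positivity
  set A := (C1 + CF * CL / (2 * M.γ)) * s * nJ with hA
  have hA0 : 0 ≤ A := by positivity
  set Bnd := ν * Real.exp (2 * M.δ₀ * M.c) * Real.exp (-(M.δ₀ * dist y y')) * (1 - 2 * M.γ * M.θ * K)⁻¹
    with hBnd
  set Rem := s * CF * (M.θ * K) * (CL * nJ) * ν with hRem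
  have hRem0 : 0 ≤ Rem := by positivity
  have hmain : ∀ Mm : ℕ, ‖Zc (D₁ (M.G (D₂ J)))‖ ≤ A * Bnd + Rem * (2 * M.γ * M.θ * K) ^ Mm := by
    intro Mm
    have hexp := walk_expansion (S := S) M.h118 M.h71 M.h71' Mm
    have hG : M.G (D₂ J)
        = ∑ m ∈ Finset.range (Mm + 1), ∑ ω : Fin (m + 1) → S,
              M.H (ω 0) (U M.G M.H (Kop M.Δa M.H) m ω (D₂ J))
          + ∑ ω : Fin (Mm + 1) → S,
              M.G (Kop M.Δa M.H (ω 0) (U M.G M.H (Kop M.Δa M.H) Mm ω (D₂ J))) := by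
      have := LinearMap.congr_fun hexp (D₂ J)
      simpa only [LinearMap.add_apply, LinearMap.sum_apply, Module.End.mul_apply] using this
    have hE : Zc (D₁ (M.G (D₂ J)))
        = ∑ m ∈ Finset.range (Mm + 1), ∑ ω : Fin (m + 1) → S,
              Zc (D₁ (M.H (ω 0) (U M.G M.H (Kop M.Δa M.H) m ω (D₂ J))))
          + ∑ ω : Fin (Mm + 1) → S,
              Zc (D₁ (M.G (Kop M.Δa M.H (ω 0) (U M.G M.H (Kop M.Δa M.H) Mm ω (D₂ J))))) := by
      rw [hG]; simp only [map_add, map_sum]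
    calc ‖Zc (D₁ (M.G (D₂ J)))‖
        ≤ ‖∑ m ∈ Finset.range (Mm + 1), ∑ ω : Fin (m + 1) → S,
              Zc (D₁ (M.H (ω 0) (U M.G M.H (Kop M.Δa M.H) m ω (D₂ J))))‖
          + ‖∑ ω : Fin (Mm + 1) → S,
              Zc (D₁ (M.G (Kop M.Δa M.H (ω 0) (U M.G M.H (Kop M.Δa M.H) Mm ω (D₂ J)))))‖ := by
          rw [hE]; exact norm_add_le _ _
      _ ≤ ∑ m ∈ Finset.range (Mm + 1), ∑ ω : Fin (m + 1) → S,
              ‖Zc (D₁ (M.H (ω 0) (U M.G M.H (Kop M.Δa M.H) m ω (D₂ J))))‖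
          + ∑ ω : Fin (Mm + 1) → S,
              ‖Zc (D₁ (M.G (Kop M.Δa M.H (ω 0) (U M.G M.H (Kop M.Δa M.H) Mm ω (D₂ J)))))‖ := by
          gcongr
          · exact le_trans (norm_sum_le _ _) (Finset.sum_le_sum fun m _ => norm_sum_le _ _)
          · exact norm_sum_le _ _
      _ ≤ ∑ m ∈ Finset.range (Mm + 1), A * ((2 * M.γ * M.θ) ^ m * walkSum M.ctr M.δ₀ M.c m y y')
          + Rem * ((2 * M.γ * M.θ) ^ Mm * K ^ Mm) := by
          gcongr with m hm
          · exact M.right_terms_sum hCF hCL hC1 hs hnJ hF hZ hZloc hJloc hL hOne m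
          · have := M.right_remainder_sum hCF hCL hs hnJ hK hrow (hν y') hDG hZ hJloc hL Mm
            simpa only [hRem] using this
      _ = A * ∑ m ∈ Finset.range (Mm + 1), (2 * M.γ * M.θ) ^ m * walkSum M.ctr M.δ₀ M.c m y y'
          + Rem * (2 * M.γ * M.θ * K) ^ Mm := by rw [Finset.mul_sum]; ring
      _ ≤ A * Bnd + Rem * (2 * M.γ * M.θ * K) ^ Mm := by
          gcongr
          exact walkSeries_le M.ctr M.δ₀ M.c K ν (2 * M.γ * M.θ) M.δ₀_nonneg hK hΘ0 hν0 hrow hsmall y y'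
            (hν y) (Mm + 1)
  have hfin := le_of_forall_geom hq0 hsmall hmain
  calc ‖Zc (D₁ (M.G (D₂ J)))‖ ≤ A * Bnd := hfin
    _ = _ := by simp only [hA, hBnd]; ring

/-- **The `ω`-terms for a LEFT entry `ζ G D₂ J`** (`D₂ ∈ {∇*, ∇*∇*}`), p. 39, verbatim: "in the estimates of `G∇*J` we
have to take a representation of G adjoint to (1.123), with the operators K(h) acting on the right" — realised here
by DUALITY: `⟨φ, ζ G D₂ J⟩ = ⟨D₂† G ζ φ, J⟩` and the (right) expansion of `G(ζφ)`; each term is bounded by the first-factor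
estimate (1.125) for `D₂†` (`hF`), `tail_bound` and `‖h_z ζ φ‖ ≤ |ζ|‖φ‖`, and vanishes unless `y′ ∈ □_{ω₀}` and
`y ∈ □_{ω_m}`. [cite: Balaban1984PropagatorsI, p.39, (1.123) p.37, (1.125)–(1.131) p.38] -/
theorem left_terms_sum {Dadj D₂ Zc : Module.End ℝ V} {CF s nJ : ℝ} (hCF : 0 ≤ CF) (hs : 0 ≤ s)
    {y y' : X} {J : V} (φ : V)
    (hF : ∀ (z : S) (B : V), ‖Dadj (M.H z (M.G B))‖ ≤ CF * ‖B‖)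
    (hadj : ∀ u v : V, inner ℝ (Dadj u) v = inner ℝ u (D₂ v))
    (hZ : ∀ v, ‖Zc v‖ ≤ s * ‖v‖)
    (hZloc : ∀ z, ¬ dist y (M.ctr z) ≤ M.c → M.H z * Zc = 0)
    (hJloc : ∀ z, ¬ dist (M.ctr z) y' ≤ M.c → M.H z (D₂ J) = 0) (hJn : ‖J‖ ≤ nJ) (m : ℕ) :
    ∑ ω : Fin (m + 1) → S, |inner ℝ (Dadj (M.H (ω 0) (U M.G M.H (Kop M.Δa M.H) m ω (Zc φ)))) J|
      ≤ CF * s * nJ * ‖φ‖ * ((2 * M.γ * M.θ) ^ m * walkSum M.ctr M.δ₀ M.c m y' y) := by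
  have hγ := M.γ_pos
  have hθ := M.θ_nonneg
  have hΘ0 : 0 ≤ 2 * M.γ * M.θ := by positivity
  have hφ := norm_nonneg φ
  unfold walkSum
  rw [Finset.mul_sum, Finset.mul_sum]
  refine Finset.sum_le_sum fun ω _ => ?_
  split_ifs with h
  · set x := Dadj (M.H (ω 0) (U M.G M.H (Kop M.Δa M.H) m ω (Zc φ))) with hx
    have hxb : ‖x‖ ≤ CF * s * ‖φ‖ * ((2 * M.γ * M.θ) ^ m * walkWeight M.ctr (2 * M.δ₀) m ω) := by
      cases m with
      | zero =>
        rw [walkWeight_zero, pow_zero, mul_one, mul_one]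
        calc ‖x‖ = ‖Dadj (M.H (ω 0) (M.G (M.H (ω 0) (Zc φ))))‖ := by simp [hx, Module.End.mul_apply]
          _ ≤ CF * ‖M.H (ω 0) (Zc φ)‖ := hF _ _
          _ ≤ CF * ‖Zc φ‖ := by gcongr; exact M.norm_H_le _ _
          _ ≤ CF * (s * ‖φ‖) := by gcongr; exact hZ _
          _ = CF * s * ‖φ‖ := by ring
      | succ m =>
        set W := walkWeight M.ctr (2 * M.δ₀) (m + 1) ω with hW
        have hW0 : 0 ≤ W := walkWeight_nonneg _ _ _ _
        have hfb := M.first_bound hF hCF m ω (Zc φ)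
        have hl : hnorm M.Dg (M.G (M.H (ω (Fin.last (m + 1))) (Zc φ))) ≤ 2 * M.γ * (s * ‖φ‖) := by
          calc hnorm M.Dg (M.G (M.H (ω (Fin.last (m + 1))) (Zc φ)))
              ≤ 2 * M.γ * ‖M.H (ω (Fin.last (m + 1))) (Zc φ)‖ := M.hnorm_G_le _
            _ ≤ 2 * M.γ * ‖Zc φ‖ := by gcongr; exact M.norm_H_le _ _
            _ ≤ 2 * M.γ * (s * ‖φ‖) := by gcongr; exact hZ _
        calc ‖x‖ ≤ CF * M.θ * (2 * M.γ * M.θ) ^ m * W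
              * hnorm M.Dg (M.G (M.H (ω (Fin.last (m + 1))) (Zc φ))) := hfb
          _ ≤ CF * M.θ * (2 * M.γ * M.θ) ^ m * W * (2 * M.γ * (s * ‖φ‖)) := by gcongr
          _ = CF * s * ‖φ‖ * ((2 * M.γ * M.θ) ^ (m + 1) * W) := by ring
    calc |inner ℝ x J| ≤ ‖x‖ * ‖J‖ := abs_real_inner_le_norm _ _
      _ ≤ (CF * s * ‖φ‖ * ((2 * M.γ * M.θ) ^ m * walkWeight M.ctr (2 * M.δ₀) m ω)) * nJ := by
          gcongr
          · have : 0 ≤ walkWeight M.ctr (2 * M.δ₀) m ω := walkWeight_nonneg _ _ _ _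
            positivity
      _ = _ := by ring
  · rw [mul_zero, mul_zero]
    rw [not_and_or] at h
    rcases h with hy' | hy
    · have h1 : ¬ dist (M.ctr (ω 0)) y' ≤ M.c := by rwa [dist_comm] at hy'
      have h2 := hJloc _ h1
      rw [hadj, M.symmH, h2, inner_zero_right, abs_zero]
    · have h1 : ¬ dist y (M.ctr (ω (Fin.last m))) ≤ M.c := by rwa [dist_comm] at hy
      have h2 : M.H (ω (Fin.last m)) (Zc φ) = 0 := by
        have := LinearMap.congr_fun (hZloc _ h1) φ
        simpa only [Module.End.mul_apply, LinearMap.zero_apply] using this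
      have hU := U_apply_eq_zero M.G M.H (Kop M.Δa M.H) m ω (Zc φ) h2
      rw [hU, map_zero, map_zero, inner_zero_left, abs_zero]

/-- **The remainder for a LEFT entry**: `Σ_ω |⟨D₂† G K(h_{ω₀}) U_ω ζφ, J⟩| ≤ C_F θK ‖J‖ 2γ|ζ|‖φ‖ ν (2γθK)^M`.
[cite: Balaban1984PropagatorsI, p.39, (1.131) p.38] -/
theorem left_remainder_sum {Dadj Zc : Module.End ℝ V} {CF s nJ K ν : ℝ} (hCF : 0 ≤ CF) (hs : 0 ≤ s)
    (hnJ : 0 ≤ nJ) (hK : 0 ≤ K) {y : X} {J : V} (φ : V)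
    (hrow : ∀ a : S, ∑ b : S, Real.exp (-(M.δ₀ * dist (M.ctr a) (M.ctr b))) ≤ K)
    (hν : ((Finset.univ.filter fun z : S => dist y (M.ctr z) ≤ M.c).card : ℝ) ≤ ν)
    (hDG : ∀ B : V, ‖Dadj (M.G B)‖ ≤ CF * ‖B‖)
    (hZ : ∀ v, ‖Zc v‖ ≤ s * ‖v‖)
    (hZloc : ∀ z, ¬ dist y (M.ctr z) ≤ M.c → M.H z * Zc = 0) (hJn : ‖J‖ ≤ nJ) (Mm : ℕ) :
    ∑ ω : Fin (Mm + 1) → S,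
        |inner ℝ (Dadj (M.G (Kop M.Δa M.H (ω 0) (U M.G M.H (Kop M.Δa M.H) Mm ω (Zc φ))))) J|
      ≤ CF * (M.θ * K) * nJ * (2 * M.γ * (s * ‖φ‖)) * ν * ((2 * M.γ * M.θ) ^ Mm * K ^ Mm) := by
  have hγ := M.γ_pos
  have hθ := M.θ_nonneg
  have hΘ0 : 0 ≤ 2 * M.γ * M.θ := by positivity
  have hφ := norm_nonneg φ
  set ind : S → ℝ := fun z => if dist y (M.ctr z) ≤ M.c then 1 else 0 with hind
  have h0 : ∀ z, 0 ≤ ind z := by intro z; simp only [hind]; split_ifs <;> norm_num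
  have hνsum : ∑ z, ind z ≤ ν := by
    have : ∑ z, ind z = ((Finset.univ.filter fun z : S => dist y (M.ctr z) ≤ M.c).card : ℝ) := by
      simp only [hind]
      rw [Finset.sum_boole]
    rw [this]; exact hν
  have hlast : ∀ ω : Fin (Mm + 1) → S,
      hnorm M.Dg (M.G (M.H (ω (Fin.last Mm)) (Zc φ))) ≤ 2 * M.γ * (s * ‖φ‖) * ind (ω (Fin.last Mm)) := by
    intro ω
    simp only [hind]
    split_ifs with hc
    · rw [mul_one]
      calc hnorm M.Dg (M.G (M.H (ω (Fin.last Mm)) (Zc φ)))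
          ≤ 2 * M.γ * ‖M.H (ω (Fin.last Mm)) (Zc φ)‖ := M.hnorm_G_le _
        _ ≤ 2 * M.γ * ‖Zc φ‖ := by gcongr; exact M.norm_H_le _ _
        _ ≤ 2 * M.γ * (s * ‖φ‖) := by gcongr; exact hZ _
    · have h2 : M.H (ω (Fin.last Mm)) (Zc φ) = 0 := by
        have := LinearMap.congr_fun (hZloc _ hc) φ
        simpa only [Module.End.mul_apply, LinearMap.zero_apply] using this
      rw [h2, map_zero, hnorm_zero, mul_zero]
  have hterm : ∀ ω : Fin (Mm + 1) → S,
      |inner ℝ (Dadj (M.G (Kop M.Δa M.H (ω 0) (U M.G M.H (Kop M.Δa M.H) Mm ω (Zc φ))))) J|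
        ≤ CF * (M.θ * K) * nJ * (2 * M.γ * (s * ‖φ‖)) * (2 * M.γ * M.θ) ^ Mm
            * (ind (ω (Fin.last Mm)) * walkWeight M.ctr (2 * M.δ₀) Mm ω) := by
    intro ω
    set u := U M.G M.H (Kop M.Δa M.H) Mm ω (Zc φ) with hu
    have htb := M.tail_bound Mm ω (Zc φ)
    have hW0 : 0 ≤ walkWeight M.ctr (2 * M.δ₀) Mm ω := walkWeight_nonneg _ _ _ _
    calc |inner ℝ (Dadj (M.G (Kop M.Δa M.H (ω 0) u))) J|
        ≤ ‖Dadj (M.G (Kop M.Δa M.H (ω 0) u))‖ * ‖J‖ := abs_real_inner_le_norm _ _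
      _ ≤ (CF * ‖Kop M.Δa M.H (ω 0) u‖) * nJ := by gcongr; exact hDG _
      _ ≤ (CF * (M.θ * K * hnorm M.Dg u)) * nJ := by gcongr; exact M.norm_K_le hrow _ _
      _ ≤ (CF * (M.θ * K * ((2 * M.γ * M.θ) ^ Mm * walkWeight M.ctr (2 * M.δ₀) Mm ω
            * hnorm M.Dg (M.G (M.H (ω (Fin.last Mm)) (Zc φ)))))) * nJ := by gcongr
      _ ≤ (CF * (M.θ * K * ((2 * M.γ * M.θ) ^ Mm * walkWeight M.ctr (2 * M.δ₀) Mm ω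
            * (2 * M.γ * (s * ‖φ‖) * ind (ω (Fin.last Mm)))))) * nJ := by gcongr; exact hlast ω
      _ = _ := by ring
  calc ∑ ω : Fin (Mm + 1) → S,
        |inner ℝ (Dadj (M.G (Kop M.Δa M.H (ω 0) (U M.G M.H (Kop M.Δa M.H) Mm ω (Zc φ))))) J|
      ≤ ∑ ω : Fin (Mm + 1) → S, CF * (M.θ * K) * nJ * (2 * M.γ * (s * ‖φ‖)) * (2 * M.γ * M.θ) ^ Mm
            * (ind (ω (Fin.last Mm)) * walkWeight M.ctr (2 * M.δ₀) Mm ω) :=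
        Finset.sum_le_sum fun ω _ => hterm ω
    _ = CF * (M.θ * K) * nJ * (2 * M.γ * (s * ‖φ‖)) * (2 * M.γ * M.θ) ^ Mm
            * ∑ ω : Fin (Mm + 1) → S, ind (ω (Fin.last Mm)) * walkWeight M.ctr (2 * M.δ₀) Mm ω := by
        rw [Finset.mul_sum]
    _ ≤ CF * (M.θ * K) * nJ * (2 * M.γ * (s * ‖φ‖)) * (2 * M.γ * M.θ) ^ Mm * (ν * K ^ Mm) := by
        apply mul_le_mul_of_nonneg_left _ (by positivity)
        exact lastSum_le M.ctr (2 * M.δ₀) K ν hK (M.col_two_le hrow) ind h0 hνsum Mm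
    _ = _ := by ring

/-- **LEFT ENTRY THEOREM — (1.131)/(1.114) in L² form for an entry `ζ G D₂ J`, via the adjoint representation of
p. 39.**  `‖ζ G D₂ J‖ ≤ C_F ν e^{2δ₀c} (1 − 2γθK)⁻¹ e^{−δ₀ d(y,y′)} |ζ| ‖J‖`.
[cite: Balaban1984PropagatorsI, p.39, (1.123) p.37, (1.125)–(1.131) p.38, (1.114) p.36] -/
theorem left_entry {K ν : ℝ} (hK : 0 ≤ K)
    (hrow : ∀ a : S, ∑ b : S, Real.exp (-(M.δ₀ * dist (M.ctr a) (M.ctr b))) ≤ K)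
    (hν : ∀ x : X, ((Finset.univ.filter fun z : S => dist x (M.ctr z) ≤ M.c).card : ℝ) ≤ ν)
    (hsmall : 2 * M.γ * M.θ * K < 1)
    {Dadj D₂ Zc : Module.End ℝ V} {CF s nJ : ℝ} (hCF : 0 ≤ CF) (hs : 0 ≤ s) (hnJ : 0 ≤ nJ)
    {y y' : X} {J : V}
    (hF : ∀ (z : S) (B : V), ‖Dadj (M.H z (M.G B))‖ ≤ CF * ‖B‖)
    (hDG : ∀ B : V, ‖Dadj (M.G B)‖ ≤ CF * ‖B‖)
    (hadj : ∀ u v : V, inner ℝ (Dadj u) v = inner ℝ u (D₂ v))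
    (hZsymm : ∀ u v : V, inner ℝ (Zc u) v = inner ℝ u (Zc v))
    (hZ : ∀ v, ‖Zc v‖ ≤ s * ‖v‖)
    (hZloc : ∀ z, ¬ dist y (M.ctr z) ≤ M.c → M.H z * Zc = 0)
    (hJloc : ∀ z, ¬ dist (M.ctr z) y' ≤ M.c → M.H z (D₂ J) = 0) (hJn : ‖J‖ ≤ nJ) :
    ‖Zc (M.G (D₂ J))‖
      ≤ CF * ν * Real.exp (2 * M.δ₀ * M.c) * (1 - 2 * M.γ * M.θ * K)⁻¹
          * Real.exp (-(M.δ₀ * dist y y')) * s * nJ := by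
  have hγ := M.γ_pos
  have hθ := M.θ_nonneg
  have hΘ0 : 0 ≤ 2 * M.γ * M.θ := by positivity
  have hν0 : 0 ≤ ν := le_trans (Nat.cast_nonneg _) (hν y)
  have hq0 : 0 ≤ 2 * M.γ * M.θ * K := by positivity
  have hinv0 : 0 ≤ (1 - 2 * M.γ * M.θ * K)⁻¹ := inv_nonneg.mpr (by linarith)
  set Bnd := ν * Real.exp (2 * M.δ₀ * M.c) * Real.exp (-(M.δ₀ * dist y' y)) * (1 - 2 * M.γ * M.θ * K)⁻¹
    with hBnd
  have hBnd0 : 0 ≤ Bnd := by positivity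
  have hφb : ∀ φ : V, |inner ℝ φ (Zc (M.G (D₂ J)))| ≤ (CF * s * nJ * Bnd) * ‖φ‖ := by
    intro φ
    have hφ := norm_nonneg φ
    set Rem := CF * (M.θ * K) * nJ * (2 * M.γ * (s * ‖φ‖)) * ν with hRem
    have hRem0 : 0 ≤ Rem := by positivity
    have hdual : inner ℝ φ (Zc (M.G (D₂ J))) = inner ℝ (Dadj (M.G (Zc φ))) J := by
      rw [← hZsymm, ← M.symmG, ← hadj]
    have hmain : ∀ Mm : ℕ,
        |inner ℝ φ (Zc (M.G (D₂ J)))| ≤ CF * s * nJ * ‖φ‖ * Bnd + Rem * (2 * M.γ * M.θ * K) ^ Mm := by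
      intro Mm
      have hexp := walk_expansion (S := S) M.h118 M.h71 M.h71' Mm
      have hG : M.G (Zc φ)
          = ∑ m ∈ Finset.range (Mm + 1), ∑ ω : Fin (m + 1) → S,
                M.H (ω 0) (U M.G M.H (Kop M.Δa M.H) m ω (Zc φ))
            + ∑ ω : Fin (Mm + 1) → S,
                M.G (Kop M.Δa M.H (ω 0) (U M.G M.H (Kop M.Δa M.H) Mm ω (Zc φ))) := by
        have := LinearMap.congr_fun hexp (Zc φ)
        simpa only [LinearMap.add_apply, LinearMap.sum_apply, Module.End.mul_apply] using this
      have hE : inner ℝ (Dadj (M.G (Zc φ))) J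
          = ∑ m ∈ Finset.range (Mm + 1), ∑ ω : Fin (m + 1) → S,
                inner ℝ (Dadj (M.H (ω 0) (U M.G M.H (Kop M.Δa M.H) m ω (Zc φ)))) J
            + ∑ ω : Fin (Mm + 1) → S,
                inner ℝ (Dadj (M.G (Kop M.Δa M.H (ω 0) (U M.G M.H (Kop M.Δa M.H) Mm ω (Zc φ))))) J := by
        rw [hG]; simp only [map_add, map_sum, inner_add_left, sum_inner]
      rw [hdual, hE]
      calc |∑ m ∈ Finset.range (Mm + 1), ∑ ω : Fin (m + 1) → S,
                inner ℝ (Dadj (M.H (ω 0) (U M.G M.H (Kop M.Δa M.H) m ω (Zc φ)))) J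
            + ∑ ω : Fin (Mm + 1) → S,
                inner ℝ (Dadj (M.G (Kop M.Δa M.H (ω 0) (U M.G M.H (Kop M.Δa M.H) Mm ω (Zc φ))))) J|
          ≤ ∑ m ∈ Finset.range (Mm + 1), ∑ ω : Fin (m + 1) → S,
                |inner ℝ (Dadj (M.H (ω 0) (U M.G M.H (Kop M.Δa M.H) m ω (Zc φ)))) J|
            + ∑ ω : Fin (Mm + 1) → S,
                |inner ℝ (Dadj (M.G (Kop M.Δa M.H (ω 0) (U M.G M.H (Kop M.Δa M.H) Mm ω (Zc φ))))) J| := by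
            refine le_trans (abs_add_le _ _) (add_le_add ?_ (Finset.abs_sum_le_sum_abs _ _))
            exact le_trans (Finset.abs_sum_le_sum_abs _ _)
              (Finset.sum_le_sum fun m _ => Finset.abs_sum_le_sum_abs _ _)
        _ ≤ ∑ m ∈ Finset.range (Mm + 1), CF * s * nJ * ‖φ‖ * ((2 * M.γ * M.θ) ^ m * walkSum M.ctr M.δ₀ M.c m y' y)
            + Rem * ((2 * M.γ * M.θ) ^ Mm * K ^ Mm) := by
            gcongr with m hm
            · exact M.left_terms_sum hCF hs φ hF hadj hZ hZloc hJloc hJn m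
            · have := M.left_remainder_sum hCF hs hnJ hK φ hrow (hν y) hDG hZ hZloc hJn Mm
              simpa only [hRem] using this
        _ = CF * s * nJ * ‖φ‖ * ∑ m ∈ Finset.range (Mm + 1), (2 * M.γ * M.θ) ^ m * walkSum M.ctr M.δ₀ M.c m y' y
            + Rem * (2 * M.γ * M.θ * K) ^ Mm := by rw [Finset.mul_sum]; ring
        _ ≤ CF * s * nJ * ‖φ‖ * Bnd + Rem * (2 * M.γ * M.θ * K) ^ Mm := by
            gcongr
            exact walkSeries_le M.ctr M.δ₀ M.c K ν (2 * M.γ * M.θ) M.δ₀_nonneg hK hΘ0 hν0 hrow hsmall y' y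
              (hν y') (Mm + 1)
    have hfin := le_of_forall_geom hq0 hsmall hmain
    calc |inner ℝ φ (Zc (M.G (D₂ J)))| ≤ CF * s * nJ * ‖φ‖ * Bnd := hfin
      _ = (CF * s * nJ * Bnd) * ‖φ‖ := by ring
  have hfin := norm_le_of_inner_bound (by positivity) hφb
  calc ‖Zc (M.G (D₂ J))‖ ≤ CF * s * nJ * Bnd := hfin
    _ = _ := by simp only [hBnd]; rw [dist_comm y' y]; ring

end Model

end Analysis

/-! ## §3. The family: located printed leaves per instance, the choice of `M₀`, and the discharge of `S1′` -/

section Family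

/-- **Uniform constants of the family** — the `O(1)`'s of pp. 38–39, verbatim p. 39: "Let us notice that the constant
O(1) under the sum above is an absolute constant depending on d only, hence we can fix M₀ depending on d only, such
that the series is convergent."  `cbar` = the locality radius of `ζ`, `J`, `∇`, `∇*` in units of `M₀`; `nu` = the
number of cubes `□_z` near a point; `Kbar` = the row sum `Σ_{x∈Z^d} e^{−δ₀M₀|x|}` (with `δ₀M₀ = ½`); `thetaBar δ′₀ C` =
the `O(1)·M₀` of (1.128) as a function of the constants `δ′₀`, `O(1)` of (1.126); `cF`, `cL`, `c1` = the `O(1)`'s of the L² forms of (1.125),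
(1.129), (1.130) as functions of `γ₀`. [cite: Balaban1984PropagatorsI, pp.38–39] -/
structure Consts where
  cbar : ℝ
  nu : ℝ
  Kbar : ℝ
  thetaBar : ℝ → ℝ → ℝ
  cF : ℝ → ℝ
  cL : ℝ → ℝ
  c1 : ℝ → ℝ
  cbar_nonneg : 0 ≤ cbar
  nu_nonneg : 0 ≤ nu
  Kbar_nonneg : 0 ≤ Kbar
  thetaBar_nonneg : ∀ δ C, 0 ≤ thetaBar δ C
  cF_nonneg : ∀ t, 0 ≤ cF t
  cL_nonneg : ∀ t, 0 ≤ cL t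
  c1_nonneg : ∀ t, 0 ≤ c1 t

section Certs

variable {V : Type} [NormedAddCommGroup V] [InnerProductSpace ℝ V] {S X : Type} [Fintype S]
  [PseudoMetricSpace X]

/-- **RIGHT certificate for one entry of (1.114)** written `ζ D₁ G D₂ J` (used for `ζGJ`, `ζ∇GJ`, `ζ∇G∇*J`, `ζ∇∇GJ`):
the L² forms of the printed factor estimates — (1.125) p. 38 (first factor, verbatim: "For the first factor we have
`‖ζ∇h_zGh_zA‖_α ≤ O(1)(‖ζ‖_α + |ζ|)|h_zA|`") as `‖D₁ h_z G B‖ ≤ c_F‖B‖` and `‖D₁ G B‖ ≤ c_F‖B‖` ((1.89));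
the locality of `ζ D₁` (supp ζ ⊂ Δ̃(y): `ζ D₁ h_z = 0` unless `□_z` is within `c̄M₀` of `y`); (1.129) p. 38 (last
factor, verbatim: "The last factor in each term is estimated by using (1.115), (1.116)
`|∇Gh_z∇*J| + |Gh_z∇*J| ≤ O(1)(‖J‖_ε + |J|)`") in L² as `|∇Gh_zD₂J| + |Gh_zD₂J| ≤ c_L‖J‖`; and
(1.130) p. 38 (the one-factor term, verbatim: "There is one possibility left yet, namely that of the terms with one
factor. Then we apply the inequality (1.117) together with (1.115), (1.116) and we get
`‖ζ∇h_zGh_z∇*J‖_α ≤ O(1)(‖ζ‖_α + |ζ|)(‖J‖_{α+ε} + |J|)`.  (1.130)") in L² as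
`‖ζD₁h_zGh_zD₂J‖ ≤ c₁|ζ|‖J‖`.  The L² readings are the ones p. 39 invokes, verbatim: "Let us notice that the proof of
inequalities (1.114), describing the decay in L²-norms, is completed because we have proved inequalities (1.89)."
LOCATED LEAVES (GAPS G-B5-24), not proved here. [cite: Balaban1984PropagatorsI, (1.125), (1.129), (1.130) p.38, p.39] -/
def RightCert (St : B5.Setting) (G Dg : Module.End ℝ V) (H : S → Module.End ℝ V) (ctr : S → X)
    (site : St.Site → X) (vec : St.Loc → V) (cut : St.Cut → Module.End ℝ V)
    (D₁ D₂ : Module.End ℝ V) (c CF CL C1 : ℝ) : Prop :=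
  (∀ (z : S) (B : V), ‖D₁ (H z (G B))‖ ≤ CF * ‖B‖) ∧
  (∀ B : V, ‖D₁ (G B)‖ ≤ CF * ‖B‖) ∧
  (∀ (ζ : St.Cut) (y : St.Site), St.cutIn ζ y → ∀ z : S, ¬ dist (site y) (ctr z) ≤ c → cut ζ * D₁ * H z = 0) ∧
  (∀ (J : St.Loc) (z : S), ‖Dg (G (H z (D₂ (vec J))))‖ + ‖G (H z (D₂ (vec J)))‖ ≤ CL * St.l2Norm J) ∧
  (∀ (ζ : St.Cut) (J : St.Loc) (z : S),
      ‖cut ζ (D₁ (H z (G (H z (D₂ (vec J))))))‖ ≤ C1 * St.cutSup ζ * St.l2Norm J)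

/-- **LEFT certificate for one entry of (1.114)** written `ζ G D₂ J` (used for `ζG∇*J`, `ζG∇*∇*J`, optionally `ζGJ`),
p. 39, verbatim: "The proofs of the other inequalities are exactly the same, but in the estimates of G∇*J we have to
take a representation of G adjoint to (1.123), with the operators K(h) acting on the right.": `D₁ = 1`, the first-factor estimate (1.125)
for the ADJOINT `D₂†` (`Dadj`), the adjoint pair `⟨D₂†u, v⟩ = ⟨u, D₂v⟩`, and the locality of `ζ` (`h_z ζ = 0` unless `□_z`
is within `c̄M₀` of `y`).  LOCATED LEAVES (GAPS G-B5-24). [cite: Balaban1984PropagatorsI, p.39, (1.125) p.38] -/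
def LeftCert (St : B5.Setting) (G : Module.End ℝ V) (H : S → Module.End ℝ V) (ctr : S → X)
    (site : St.Site → X) (cut : St.Cut → Module.End ℝ V) (D₁ Dadj D₂ : Module.End ℝ V) (c CF : ℝ) : Prop :=
  D₁ = 1 ∧
  (∀ (z : S) (B : V), ‖Dadj (H z (G B))‖ ≤ CF * ‖B‖) ∧
  (∀ B : V, ‖Dadj (G B)‖ ≤ CF * ‖B‖) ∧
  (∀ u v : V, inner ℝ (Dadj u) v = inner ℝ u (D₂ v)) ∧
  (∀ (ζ : St.Cut) (y : St.Site), St.cutIn ζ y → ∀ z : S, ¬ dist (site y) (ctr z) ≤ c → H z * cut ζ = 0)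

end Certs

/-- **An L² realisation of one instance `St = (k, T_η)` of `B5.Setting` at cube scale `M₀`** — the DICTIONARY between
the abstract carrier of `B5.lean` and the L² walk machine of pp. 36–39, with every non-derived input a LOCATED
PRINTED-SHAPE LEAF (GAPS G-B5-24; each field's docstring names its display):
* carriers (parameters): `V` = `L²` sections on `T_η` (a real inner-product space), `X` ⊇ the unit lattice with a
  pseudometric dominating `|y − y′|` (`hdist`), `S` = the finite set of centres `z ∈ T^{(k+m₀)}_{M₀}` of the cubes `□_z`
  (p. 36);
* operators: `G = Δ_a⁻¹` (1.71) p. 30 `h71`, `h71'`; `Δa`; the gradient `Dg = ∇`; the partition of unity `H z = h_z` with (1.118)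
  `h118` (verbatim p. 36: "We construct a partition of unity taking the functions `h_z(x) = Π_{μ=1}^d h((x_μ − z_μ)/M₀)`,
  `h ∈ C₀^∞(]−⅔, ⅔[)`, `h(t) = 1` for `t ∈ [−⅓, ⅓]`, h is chosen in such a way that `Σ_n h²(t − n) = 1`, hence
  `Σ_z h_z²(x) = 1`.  (1.118)"); the six entries of (1.114) as `cut ζ ∘ D1 n ∘ G ∘ D2 n` applied to
  `vec J` (`hentry`), with `D1 = (1, ∇, 1, ∇, ∇∇, 1)`, `D2 = (1, 1, ∇*, ∇*, 1, ∇*∇*)`, `Dadj n` = the adjoint of `D2 n`;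
* symmetry: `symmG` (p. 33, verbatim: "The operator G is a symmetric operator on L²(T_η)"), `symmH`, `symmCut` (real
  multiplication operators) [folklore];
* sizes: `hvec` (`‖J‖_{L²} ≤ ‖J‖`), `hcut`/`hcut0` (`‖ζv‖ ≤ |ζ|‖v‖`), `hentry` (`l2loc n J ζ` IS the L² norm of the entry);
* geometry of the cube cover at scale `M₀` (p. 36, verbatim: "cubes □_z of size 2M₀ and with a center at the point
  z … These cubes cover the lattice T_η"): `hν` (a point is within `c̄M₀` of at most `ν` centres), `hrow` (the row sums
  `Σ_{z′} e^{−|z−z′|/(2M₀)} ≤ K̄` = the printed `Σ_{x∈Z^d} e^{−δ₀M₀|x|}` of (1.131) with `δ₀M₀ = ½`; Z^d model in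
  `B5Walk131.row_sum_le_lattice`, `card_cubes_containing_le`), `hJloc` (supp J ⊂ Δ̃(y′) and the locality of `D2 n`);
* the two printed analytic inputs: `h89` = (1.89) p. 33 read on the model (`‖GB‖, ‖∇GB‖ ≤ γ₀⁻¹‖B‖` whenever the
  abstract Prop. 1.1 clause holds with `γ₀`), and `h128` = (1.128) p. 38 in L² form, verbatim: "Defining
  `2δ₀ = min{⅓δ′₀, M₀⁻¹}`, we obtain `|h_{z₁}K(h_{z₂})A| ≤ O(M₀⁻¹) e^{−2δ₀|z₁−z₂|} (|∇A| + |A|)`.  (1.128)", derived in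
  print from (1.126) — here a leaf taking the (1.126) constants `δ′₀, C` of `B5.Kernel126_127Printed` as input;
* per entry, a right or left certificate (`RightCert` / `LeftCert`) with the uniform constants `κ`.
Nothing in this structure is proved in this file: it is the hypothesis of `local114_of_realisation`, to be
instantiated on the concrete torus model (surge node T02.1 territory).  [cite: Balaban1984PropagatorsI, pp.36–39, (1.89) p.33, (1.114) p.36] -/
structure Realisation (St : B5.Setting) (kd : B5.KernelData) (M₀ : ℕ) (κ : Consts)
    (V : Type) [NormedAddCommGroup V] [InnerProductSpace ℝ V] (X : Type) [PseudoMetricSpace X]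
    (S : Type) [Fintype S] : Type where
  G : Module.End ℝ V
  Δa : Module.End ℝ V
  H : S → Module.End ℝ V
  Dg : Module.End ℝ V
  ctr : S → X
  site : St.Site → X
  vec : St.Loc → V
  cut : St.Cut → Module.End ℝ V
  D1 : Fin 6 → Module.End ℝ V
  D2 : Fin 6 → Module.End ℝ V
  Dadj : Fin 6 → Module.End ℝ V
  /-- (1.118) p. 36: `Σ_z h_z² = 1`. -/
  h118 : ∑ z, H z * H z = 1
  /-- (1.71) p. 30: "`Δ_a⁻¹ = G_k`, or simply G.  (1.71)", "It is an invertible operator". -/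
  h71 : Δa * G = 1
  h71' : G * Δa = 1
  /-- p. 33: "The operator G is a symmetric operator on L²(T_η)". -/
  symmG : ∀ u v : V, inner ℝ (G u) v = inner ℝ u (G v)
  symmH : ∀ (z : S) (u v : V), inner ℝ (H z u) v = inner ℝ u (H z v)
  symmCut : ∀ (ζ : St.Cut) (u v : V), inner ℝ (cut ζ u) v = inner ℝ u (cut ζ v)
  /-- dictionary of sizes. -/
  hdist : ∀ y y' : St.Site, St.dist y y' ≤ dist (site y) (site y')
  hvec : ∀ J : St.Loc, ‖vec J‖ ≤ St.l2Norm J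
  hcut : ∀ (ζ : St.Cut) (v : V), ‖cut ζ v‖ ≤ St.cutSup ζ * ‖v‖
  hcut0 : ∀ ζ : St.Cut, 0 ≤ St.cutSup ζ
  hentry : ∀ (n : Fin 6) (J : St.Loc) (ζ : St.Cut), St.l2loc n J ζ ≤ ‖cut ζ (D1 n (G (D2 n (vec J))))‖
  /-- geometry of the cube cover at scale `M₀` (p. 36) and the row sum of (1.131). -/
  hν : ∀ x : X, ((Finset.univ.filter fun z : S => dist x (ctr z) ≤ κ.cbar * M₀).card : ℝ) ≤ κ.nu
  hrow : ∀ a : S, ∑ b : S, Real.exp (-((2 * (M₀ : ℝ))⁻¹ * dist (ctr a) (ctr b))) ≤ κ.Kbar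
  hJloc : ∀ (n : Fin 6) (J : St.Loc) (y' : St.Site), St.suppIn J y' →
    ∀ z : S, ¬ dist (ctr z) (site y') ≤ κ.cbar * M₀ → H z (D2 n (vec J)) = 0
  /-- (1.89) p. 33 read on the model. -/
  h89 : ∀ γ₀ : ℝ, 0 < γ₀ → (∀ (n : Fin 6) (J : St.Loc), St.l2op n J ≤ γ₀⁻¹ * St.l2Norm J) →
    (∀ B : V, ‖G B‖ ≤ γ₀⁻¹ * ‖B‖) ∧ (∀ B : V, ‖Dg (G B)‖ ≤ γ₀⁻¹ * ‖B‖)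
  /-- (1.126) ⇒ (1.128) p. 38, L² form, with `2δ₀ = min{⅓δ′₀, M₀⁻¹}` (`B5Walk131.twoDelta0`). -/
  h128 : ∀ δ₀' C : ℝ, 0 < δ₀' → 0 < C →
    (∀ x x' : kd.X, |kd.ker x x'| ≤ C * Real.exp (-(δ₀' * kd.dist x x'))) →
    ∀ (z₁ z₂ : S) (A : V), ‖H z₁ (Kop Δa H z₂ A)‖
      ≤ κ.thetaBar δ₀' C / M₀ * Real.exp (-(twoDelta0 δ₀' M₀ * dist (ctr z₁) (ctr z₂))) * (‖Dg A‖ + ‖A‖)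
  /-- per entry: the right or the left certificate ((1.125), (1.129), (1.130) p. 38 / the adjoint sentence p. 39). -/
  hcert : ∀ γ₀ : ℝ, 0 < γ₀ → (∀ (n : Fin 6) (J : St.Loc), St.l2op n J ≤ γ₀⁻¹ * St.l2Norm J) →
    ∀ n : Fin 6,
      RightCert St G Dg H ctr site vec cut (D1 n) (D2 n) (κ.cbar * M₀) (κ.cF γ₀) (κ.cL γ₀) (κ.c1 γ₀) ∨
      LeftCert St G H ctr site cut (D1 n) (Dadj n) (D2 n) (κ.cbar * M₀) (κ.cF γ₀)

namespace Realisation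

variable {St : B5.Setting} {kd : B5.KernelData} {M₀ : ℕ} {κ : Consts}
  {V : Type} [NormedAddCommGroup V] [InnerProductSpace ℝ V] {X : Type} [PseudoMetricSpace X]
  {S : Type} [Fintype S] (R : Realisation St kd M₀ κ V X S)

/-- The §2 `Model` carried by a realisation, at the Prop. 1.1 constant `γ₀` and the (1.126) constants `δ′₀, C`, once
`M₀ ≥ 3/δ′₀` (so that `2δ₀ = min{⅓δ′₀, M₀⁻¹} = M₀⁻¹`, `B5Walk131.twoDelta0_eq_inv`): `γ = γ₀⁻¹`, `θ = θ̄(δ′₀,C)/M₀`,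
`δ₀ = (2M₀)⁻¹`, `c = c̄M₀`. [cite: Balaban1984PropagatorsI, p.38 before (1.128), p.39] -/
def model {γ₀ δ₀' C : ℝ} (hγ₀ : 0 < γ₀)
    (h11 : ∀ (n : Fin 6) (J : St.Loc), St.l2op n J ≤ γ₀⁻¹ * St.l2Norm J)
    (hδ : 0 < δ₀') (hC : 0 < C)
    (hker : ∀ x x' : kd.X, |kd.ker x x'| ≤ C * Real.exp (-(δ₀' * kd.dist x x')))
    (hM : (0 : ℝ) < M₀) (h3 : 3 / δ₀' ≤ (M₀ : ℝ)) : Model V S X where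
  G := R.G
  Δa := R.Δa
  H := R.H
  Dg := R.Dg
  ctr := R.ctr
  γ := γ₀⁻¹
  θ := κ.thetaBar δ₀' C / M₀
  δ₀ := (2 * (M₀ : ℝ))⁻¹
  c := κ.cbar * M₀
  h118 := R.h118
  h71 := R.h71
  h71' := R.h71'
  symmG := R.symmG
  symmH := R.symmH
  h89 := (R.h89 γ₀ hγ₀ h11).1
  h89' := (R.h89 γ₀ hγ₀ h11).2
  h128 := by
    intro z₁ z₂ A
    have h := R.h128 δ₀' C hδ hC hker z₁ z₂ A
    have htwo : twoDelta0 δ₀' (M₀ : ℝ) = 2 * (2 * (M₀ : ℝ))⁻¹ := by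
      rw [twoDelta0_eq_inv hM hδ h3]; field_simp
    rw [htwo] at h
    exact h
  γ_pos := inv_pos.mpr hγ₀
  θ_nonneg := div_nonneg (κ.thetaBar_nonneg δ₀' C) hM.le
  δ₀_nonneg := by positivity

end Realisation

/-- monotone bookkeeping for the final constant. [folklore: products of nonnegative reals are monotone] -/
theorem final_mono {B C e1 e2 s nJ : ℝ} (hBC : B ≤ C) (he : e1 ≤ e2) (hC : 0 ≤ C) (he1 : 0 ≤ e1)
    (hs : 0 ≤ s) (hnJ : 0 ≤ nJ) : B * e1 * s * nJ ≤ C * e2 * s * nJ := by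
  have h1 : B * e1 ≤ C * e2 := mul_le_mul hBC he he1 hC
  have hsn : 0 ≤ s * nJ := mul_nonneg hs hnJ
  calc B * e1 * s * nJ = (B * e1) * (s * nJ) := by ring
    _ ≤ (C * e2) * (s * nJ) := mul_le_mul_of_nonneg_right h1 hsn
    _ = C * e2 * s * nJ := by ring

/-- **DISCHARGE OF THE SLOT `S1′` OF `B5.prop12_of_printed_steps` — (1.89), (1.126) ⇒ (1.114) by the L² random-walk
expansion, p. 39, verbatim: "Let us notice that the proof of inequalities (1.114), describing the decay in L²-norms,
is completed because we have proved inequalities (1.89)."**  For a family of instances each carrying an L² realisation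
at every cube scale `M₀ ≥ 1` with uniform constants `κ` (`Realisation`: located printed leaves + dictionary; the
carriers `V`, `X`, `S` may depend on the instance and on `M₀` — in the model `S` = the `M₀`-cube centres does), the
printed Proposition 1.1 (`B5.Prop11Printed`, its clause (1.89)) and the printed kernel bounds (1.126)–(1.127)
(`B5.Kernel126_127Printed`, its clause (1.126)) imply the six localised L² bounds (1.114) with constants chosen
BEFORE the instance (`B5.Local114Fam`).  KERNEL-CHECKED HERE: the algebra (1.118)–(1.123), the product / first-factor /
remainder estimates along walks, the choice "`M₀` depending on d only such that the series is convergent" (p. 39: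
`M₀ = ⌈max{1, 3/δ′₀, 4γ₀⁻¹θ̄K̄}⌉`, giving `2δ₀ = M₀⁻¹` and ratio `2γ₀⁻¹θ̄K̄/M₀ ≤ ½`), the walk-sum bound (1.131) (imported
from `B5Walk131.walkSeries_le`), the adjoint representation for the left entries (p. 39) by inner-product duality,
and the vanishing of the truncation remainder.  Final constants: `δ₀ = (2M₀)⁻¹`,
`C = 2ν e^{c̄}·(c₁ + c_F c_L γ₀/2 + c_F) + 1`. [cite: Balaban1984PropagatorsI, p.39, (1.114) p.36, (1.118)–(1.131) pp.36–38, (1.89) p.33, (1.126) p.38] -/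
theorem local114_of_realisation {I : Type} (fam : I → B5.Setting) (Kd : I → B5.KernelData) (κ : Consts)
    {V : I → ℕ → Type} [∀ i M, NormedAddCommGroup (V i M)] [∀ i M, InnerProductSpace ℝ (V i M)]
    {X : I → ℕ → Type} [∀ i M, PseudoMetricSpace (X i M)] {S : I → ℕ → Type} [∀ i M, Fintype (S i M)]
    (real : ∀ (i : I) (M₀ : ℕ), 1 ≤ M₀ → Realisation (fam i) (Kd i) M₀ κ (V i M₀) (X i M₀) (S i M₀)) :
    B5.Prop11Printed fam → B5.Kernel126_127Printed Kd → B5.Local114Fam fam := by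
  intro h11 hleaf
  obtain ⟨γ₀, hγ₀, h11'⟩ := h11
  obtain ⟨δ₀', C, Cα, hδ₀', hC, hker⟩ := hleaf
  -- the choice of M₀ "depending on d only" (p. 39)
  obtain ⟨M₀, hM1r, h3, h4⟩ : ∃ M₀ : ℕ, (1 : ℝ) ≤ M₀ ∧ 3 / δ₀' ≤ (M₀ : ℝ) ∧
      4 * γ₀⁻¹ * κ.thetaBar δ₀' C * κ.Kbar ≤ (M₀ : ℝ) := by
    refine ⟨⌈max 1 (max (3 / δ₀') (4 * γ₀⁻¹ * κ.thetaBar δ₀' C * κ.Kbar))⌉₊, ?_, ?_, ?_⟩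
    · exact le_trans (le_max_left _ _) (Nat.le_ceil _)
    · exact le_trans (le_trans (le_max_left _ _) (le_max_right _ _)) (Nat.le_ceil _)
    · exact le_trans (le_trans (le_max_right _ _) (le_max_right _ _)) (Nat.le_ceil _)
  have hM1 : 1 ≤ M₀ := by exact_mod_cast hM1r
  have hM0 : (0 : ℝ) < M₀ := by linarith
  have hγ : (0 : ℝ) < γ₀⁻¹ := inv_pos.mpr hγ₀
  have hθb := κ.thetaBar_nonneg δ₀' C
  have hδ₀ : (0 : ℝ) < (2 * (M₀ : ℝ))⁻¹ := by positivity
  -- the ratio of the geometric series is ≤ ½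
  have hq0 : 0 ≤ 2 * γ₀⁻¹ * (κ.thetaBar δ₀' C / M₀) * κ.Kbar := by
    have := κ.Kbar_nonneg; positivity
  have hq : 2 * γ₀⁻¹ * (κ.thetaBar δ₀' C / M₀) * κ.Kbar ≤ 1 / 2 := by
    have e : 2 * γ₀⁻¹ * (κ.thetaBar δ₀' C / (M₀ : ℝ)) * κ.Kbar = (2 * γ₀⁻¹ * κ.thetaBar δ₀' C * κ.Kbar) / M₀ := by
      ring
    rw [e, div_le_iff₀ hM0]
    linarith
  have hsmall : 2 * γ₀⁻¹ * (κ.thetaBar δ₀' C / M₀) * κ.Kbar < 1 := by linarith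
  have hinv : (1 - 2 * γ₀⁻¹ * (κ.thetaBar δ₀' C / M₀) * κ.Kbar)⁻¹ ≤ 2 := by
    have h12 : (1 : ℝ) / 2 ≤ 1 - 2 * γ₀⁻¹ * (κ.thetaBar δ₀' C / M₀) * κ.Kbar := by linarith
    have := one_div_le_one_div_of_le (by norm_num : (0 : ℝ) < 1 / 2) h12
    rw [inv_eq_one_div]
    linarith [show (1 : ℝ) / (1 / 2) = 2 by norm_num]
  have hinv0 : 0 ≤ (1 - 2 * γ₀⁻¹ * (κ.thetaBar δ₀' C / M₀) * κ.Kbar)⁻¹ := inv_nonneg.mpr (by linarith)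
  -- the final constant
  have hA0 : 0 ≤ κ.c1 γ₀ + κ.cF γ₀ * κ.cL γ₀ / (2 * γ₀⁻¹) + κ.cF γ₀ := by
    have := κ.c1_nonneg γ₀; have := κ.cF_nonneg γ₀; have := κ.cL_nonneg γ₀; positivity
  have hE1 : 0 ≤ Real.exp (2 * (2 * (M₀ : ℝ))⁻¹ * (κ.cbar * M₀)) := (Real.exp_pos _).le
  refine ⟨(2 * (M₀ : ℝ))⁻¹,
    (κ.c1 γ₀ + κ.cF γ₀ * κ.cL γ₀ / (2 * γ₀⁻¹) + κ.cF γ₀) * κ.nu * Real.exp (2 * (2 * (M₀ : ℝ))⁻¹ * (κ.cbar * M₀)) * 2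
      + 1, hδ₀, ?_, ?_⟩
  · have := κ.nu_nonneg; positivity
  intro i n J ζ y y' hζ hJ
  have R := real i M₀ hM1
  have hnJ0 : 0 ≤ (fam i).l2Norm J := le_trans (norm_nonneg _) (R.hvec J)
  have hs0 : 0 ≤ (fam i).cutSup ζ := R.hcut0 ζ
  have hCfin0 : 0 ≤ (κ.c1 γ₀ + κ.cF γ₀ * κ.cL γ₀ / (2 * γ₀⁻¹) + κ.cF γ₀) * κ.nu
      * Real.exp (2 * (2 * (M₀ : ℝ))⁻¹ * (κ.cbar * M₀)) * 2 + 1 := by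
    have := κ.nu_nonneg; positivity
  have hexp : Real.exp (-((2 * (M₀ : ℝ))⁻¹ * dist (R.site y) (R.site y')))
      ≤ Real.exp (-((2 * (M₀ : ℝ))⁻¹ * (fam i).dist y y')) :=
    Real.exp_le_exp.mpr (neg_le_neg (mul_le_mul_of_nonneg_left (R.hdist y y') hδ₀.le))
  -- the §2 model of this instance
  let M : Model (V i M₀) (S i M₀) (X i M₀) := R.model hγ₀ (h11' i).1 hδ₀' hC (hker i).1 hM0 h3
  rcases R.hcert γ₀ hγ₀ (h11' i).1 n with hRt | hLt
  · -- right entry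
    obtain ⟨hF, hDG, hZloc, hL, hOne⟩ := hRt
    have key := M.right_entry (K := κ.Kbar) (ν := κ.nu) κ.Kbar_nonneg R.hrow R.hν hsmall
      (κ.cF_nonneg γ₀) (κ.cL_nonneg γ₀) (κ.c1_nonneg γ₀) hs0 hnJ0
      (D₁ := R.D1 n) (D₂ := R.D2 n) (Zc := R.cut ζ) (y := R.site y) (y' := R.site y') (J := R.vec J)
      hF hDG (R.hcut ζ) (hZloc ζ y hζ) (fun z hz => R.hJloc n J y' hJ z hz) (hL J) (hOne ζ J)
    calc (fam i).l2loc n J ζ ≤ ‖R.cut ζ (R.D1 n (R.G (R.D2 n (R.vec J))))‖ := R.hentry n J ζ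
      _ ≤ (κ.c1 γ₀ + κ.cF γ₀ * κ.cL γ₀ / (2 * γ₀⁻¹)) * κ.nu * Real.exp (2 * (2 * (M₀ : ℝ))⁻¹ * (κ.cbar * M₀))
            * (1 - 2 * γ₀⁻¹ * (κ.thetaBar δ₀' C / M₀) * κ.Kbar)⁻¹
            * Real.exp (-((2 * (M₀ : ℝ))⁻¹ * dist (R.site y) (R.site y')))
            * (fam i).cutSup ζ * (fam i).l2Norm J := key
      _ ≤ ((κ.c1 γ₀ + κ.cF γ₀ * κ.cL γ₀ / (2 * γ₀⁻¹) + κ.cF γ₀) * κ.nu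
            * Real.exp (2 * (2 * (M₀ : ℝ))⁻¹ * (κ.cbar * M₀)) * 2 + 1)
            * Real.exp (-((2 * (M₀ : ℝ))⁻¹ * (fam i).dist y y'))
            * (fam i).cutSup ζ * (fam i).l2Norm J := by
          apply final_mono _ hexp hCfin0 (Real.exp_pos _).le hs0 hnJ0
          have hν := κ.nu_nonneg
          have hcF := κ.cF_nonneg γ₀
          have s1 : (κ.c1 γ₀ + κ.cF γ₀ * κ.cL γ₀ / (2 * γ₀⁻¹)) * κ.nu
              * Real.exp (2 * (2 * (M₀ : ℝ))⁻¹ * (κ.cbar * M₀)) * (1 - 2 * γ₀⁻¹ * (κ.thetaBar δ₀' C / M₀) * κ.Kbar)⁻¹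
              ≤ (κ.c1 γ₀ + κ.cF γ₀ * κ.cL γ₀ / (2 * γ₀⁻¹)) * κ.nu
              * Real.exp (2 * (2 * (M₀ : ℝ))⁻¹ * (κ.cbar * M₀)) * 2 := by
            apply mul_le_mul_of_nonneg_left hinv
            have := κ.c1_nonneg γ₀
            have := κ.cL_nonneg γ₀
            positivity
          have s2 : (κ.c1 γ₀ + κ.cF γ₀ * κ.cL γ₀ / (2 * γ₀⁻¹)) * κ.nu
              * Real.exp (2 * (2 * (M₀ : ℝ))⁻¹ * (κ.cbar * M₀)) * 2
              ≤ (κ.c1 γ₀ + κ.cF γ₀ * κ.cL γ₀ / (2 * γ₀⁻¹) + κ.cF γ₀) * κ.nu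
              * Real.exp (2 * (2 * (M₀ : ℝ))⁻¹ * (κ.cbar * M₀)) * 2 := by
            have : κ.c1 γ₀ + κ.cF γ₀ * κ.cL γ₀ / (2 * γ₀⁻¹)
                ≤ κ.c1 γ₀ + κ.cF γ₀ * κ.cL γ₀ / (2 * γ₀⁻¹) + κ.cF γ₀ := by linarith
            gcongr
          linarith
  · -- left entry
    obtain ⟨hD1, hF, hDG, hadj, hZloc⟩ := hLt
    have key := M.left_entry (K := κ.Kbar) (ν := κ.nu) κ.Kbar_nonneg R.hrow R.hν hsmall
      (κ.cF_nonneg γ₀) hs0 hnJ0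
      (Dadj := R.Dadj n) (D₂ := R.D2 n) (Zc := R.cut ζ) (y := R.site y) (y' := R.site y') (J := R.vec J)
      hF hDG hadj (R.symmCut ζ) (R.hcut ζ) (hZloc ζ y hζ) (fun z hz => R.hJloc n J y' hJ z hz) (R.hvec J)
    have hent : (fam i).l2loc n J ζ ≤ ‖R.cut ζ (R.G (R.D2 n (R.vec J)))‖ := by
      have := R.hentry n J ζ
      rwa [hD1, Module.End.one_apply] at this
    calc (fam i).l2loc n J ζ ≤ ‖R.cut ζ (R.G (R.D2 n (R.vec J)))‖ := hent
      _ ≤ κ.cF γ₀ * κ.nu * Real.exp (2 * (2 * (M₀ : ℝ))⁻¹ * (κ.cbar * M₀))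
            * (1 - 2 * γ₀⁻¹ * (κ.thetaBar δ₀' C / M₀) * κ.Kbar)⁻¹
            * Real.exp (-((2 * (M₀ : ℝ))⁻¹ * dist (R.site y) (R.site y')))
            * (fam i).cutSup ζ * (fam i).l2Norm J := key
      _ ≤ ((κ.c1 γ₀ + κ.cF γ₀ * κ.cL γ₀ / (2 * γ₀⁻¹) + κ.cF γ₀) * κ.nu
            * Real.exp (2 * (2 * (M₀ : ℝ))⁻¹ * (κ.cbar * M₀)) * 2 + 1)
            * Real.exp (-((2 * (M₀ : ℝ))⁻¹ * (fam i).dist y y'))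
            * (fam i).cutSup ζ * (fam i).l2Norm J := by
          apply final_mono _ hexp hCfin0 (Real.exp_pos _).le hs0 hnJ0
          have hν := κ.nu_nonneg
          have hc1 := κ.c1_nonneg γ₀
          have hcF := κ.cF_nonneg γ₀
          have hcL := κ.cL_nonneg γ₀
          have s1 : κ.cF γ₀ * κ.nu * Real.exp (2 * (2 * (M₀ : ℝ))⁻¹ * (κ.cbar * M₀))
              * (1 - 2 * γ₀⁻¹ * (κ.thetaBar δ₀' C / M₀) * κ.Kbar)⁻¹
              ≤ κ.cF γ₀ * κ.nu * Real.exp (2 * (2 * (M₀ : ℝ))⁻¹ * (κ.cbar * M₀)) * 2 := by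
            apply mul_le_mul_of_nonneg_left hinv
            positivity
          have s2 : κ.cF γ₀ * κ.nu * Real.exp (2 * (2 * (M₀ : ℝ))⁻¹ * (κ.cbar * M₀)) * 2
              ≤ (κ.c1 γ₀ + κ.cF γ₀ * κ.cL γ₀ / (2 * γ₀⁻¹) + κ.cF γ₀) * κ.nu
              * Real.exp (2 * (2 * (M₀ : ℝ))⁻¹ * (κ.cbar * M₀)) * 2 := by
            have : κ.cF γ₀ ≤ κ.c1 γ₀ + κ.cF γ₀ * κ.cL γ₀ / (2 * γ₀⁻¹) + κ.cF γ₀ := by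
              have : 0 ≤ κ.cF γ₀ * κ.cL γ₀ / (2 * γ₀⁻¹) := by positivity
              linarith
            gcongr
          linarith

/-- **Corollary: Proposition 1.2 for G from its printed steps WITHOUT the slot `S1′`** — `B5.prop12_of_printed_steps`
with `S1′ : Prop11Printed fam → Kernel126_127Printed K → Local114Fam fam` supplied by `local114_of_realisation`
(the remaining slots S3, S2, S1 as there; `B5Transfer132.prop12_via132_of_printed_steps` takes the same `S1′` and is
discharged by the same term). [cite: Balaban1984PropagatorsI, Prop. 1.2 pp.35–39] -/
theorem prop12_of_printed_steps_via_walk {I : Type} (fam famG0 : I → B5.Setting) (g : ∀ i, B5.GlobalH (fam i))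
    (Kd : I → B5.KernelData) (κ : Consts)
    {V : I → ℕ → Type} [∀ i M, NormedAddCommGroup (V i M)] [∀ i M, InnerProductSpace ℝ (V i M)]
    {X : I → ℕ → Type} [∀ i M, PseudoMetricSpace (X i M)] {S : I → ℕ → Type} [∀ i M, Fintype (S i M)]
    (real : ∀ (i : I) (M₀ : ℕ), 1 ≤ M₀ → Realisation (fam i) (Kd i) M₀ κ (V i M₀) (X i M₀) (S i M₀))
    (h11 : B5.Prop11Printed fam) (hleaf : B5.Kernel126_127Printed Kd)
    (S3 : B5.Prop12Printed famG0)
    (S2 : B5.Prop12Printed famG0 → B5.Kernel126_127Printed Kd → B5.Local114Fam fam →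
      B5.Global115_117Fam fam g)
    (S1 : B5.Global115_117Fam fam g → B5.Prop11Printed fam → B5.Kernel126_127Printed Kd →
      B5.Prop12Printed fam) :
    B5.Prop12Printed fam :=
  B5.prop12_of_printed_steps fam famG0 g Kd h11 hleaf (local114_of_realisation fam Kd κ real) S3 S2 S1

end Family

end

end Literature.MathematicalPhysics.QuantumFieldTheory.Balaban1983to89.B5Local114
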